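import Literature.MathematicalPhysics.QuantumLattice.HubbardHubbardModelProofs
import Literature.MathematicalPhysics.QuantumLattice.HubbardHubbardModelPairDecayProofs
import Literature.MathematicalPhysics.QuantumLattice.HubbardHubbardModelKomaTasakiProofs
import Literature.MathematicalPhysics.QuantumLattice.XYOrderThermalProofs
import HarnessLib

/-!
# Barrier: no superconducting (or magnetic) long-range order at `T > 0` in the 2D Hubbard model (Koma–Tasaki 1992; proved)

Barrier catalogue `Literature/Barriers/HubbardSuperconductivity/` (D-0021), entry
`PositiveTemperatureNoPairLRO` — the seed barrier "Mermin–Wagner in 2D at `T > 0`" for the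
summit `HubbardSuperconductivity` (`d_{x²-y²}` pair-field long-range order in the GROUND STATES of
the doped repulsive square-lattice Hubbard model). The Hohenberg–Mermin–Wagner mechanism for
itinerant electrons is Koma–Tasaki's 1992 theorem (McBryan–Spencer complex rotations using the
global `U(1)` phase symmetry), and it is a THEOREM OF THE TREE: the named facts
`Literature.MathematicalPhysics.QuantumLattice.koma_tasaki_2d`, `koma_tasaki_1d`, `koma_tasaki_magnetic`, `koma_tasaki_noLRO` of
`Literature/MathematicalPhysics/QuantumLattice/HubbardHubbardModel.lean` (hubbard.S11) are
discharged in `HubbardHubbardModelPairDecayProofs.lean` (`koma_tasaki_2d_holds`),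
`HubbardHubbardModelKomaTasakiProofs.lean` (`koma_tasaki_magnetic_holds`, `koma_tasaki_1d_holds`)
and `HubbardHubbardModelProofs.lean` (`koma_tasaki_noLRO_of : koma_tasaki_2d →
koma_tasaki_magnetic → koma_tasaki_noLRO`). This file imports them (nothing is restated),
assembles the headline and records the BARRIER block.

## Source (as printed)

T. Koma, H. Tasaki, *Decay of superconducting and magnetic correlations in one- and
two-dimensional Hubbard models*, PRL 68 (1992) 3248 (`KomaTasakiPRL1992`, held as
`paper:arxiv-cond-mat_9709068`). Abstract: "In a general class of one and two dimensional
Hubbard models, we prove upper bounds for the two-point correlation functions at finite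
temperatures for electrons, for electron pairs, [and for spins]. The upper bounds decay
exponentially in one dimension, and with power laws in two dimensions. The bounds rule out the
possibility of the corresponding condensation of superconducting electron pairs, and of the
corresponding magnetic ordering." Theorem (p. 2): constants `α, γ, δ` and a decreasing `f(β)`,
"`f(β) ≈ 1/β`" for large `β`, depending only on the hopping matrix, with, in two dimensions,
`|⟨c†_{x↑} c†_{x↓} c_{y↑} c_{y↓} + H.c.⟩| ≤ 2|x-y|^{-α f(β)}` (2),
`|⟨c†_{xσ} c_{yσ} + H.c.⟩| ≤ 2|x-y|^{-α f(2β)/2}` (3), and for `h_x = (0, 0, h_x)`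
`|⟨S¹_x S¹_y + S²_x S²_y⟩| ≤ |x-y|^{-α f(β)}` (4), "for any finite `β`"; one dimension:
exponential bounds; p. 3: "The above bounds rigorously rule out the possibility of the
corresponding condensations of electrons or electron pairs and of the corresponding magnetic
ordering. The bound (2), for example, inhibits the condensation of singlet electron pairs such as
the Cooper pairs or the `η`-pairs. However our method can be easily extended to rule out any kind
of condensation which is related to a spontaneous breakdown of the quantum mechanical global
`U(1)` symmetry"; "It is notable that the power indices in the upper bounds (2), (3), (4) are
proportional to `β⁻¹` at low temperatures. [This suggests that the] slowest possible decay in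
these models is of the Kosterlitz-Thouless type"; p. 1: "In one and two dimensions, Ghosh [4]
proved the absence of magnetic ordering at finite temperatures. In the present letter, we extend
McBryan and Spencer's [method for] classical spin systems to a general class of Hubbard models";
the Hamiltonian class (1): arbitrary finite-range hermitian hopping, "The interaction
`V({n_{x,σ}})` is an arbitrary function of the number operators", local magnetic fields.

## Lean rendering

Headline `PositiveTemperatureNoPairLRO := koma_tasaki_2d ∧ koma_tasaki_noLRO`: the power-law
bound (2) for the on-site pair correlation of the grand-canonical Hubbard Gibbs state on the tori
`(ℤ/Lℤ)²` (`hubbardTorusWith 2 L t U μ`, `Matrix.thermalCorr`, `onSitePair`), uniformly in `L`,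
for all `t, U, μ` and `β > 0`, AND its corollary: neither the thermal pair two-point function
`thermalPairCorr` nor the transverse spin two-point function `thermalSpinCorr` has torus long-range
order (`QLattice.HasTorusLRO`) at any `β > 0`. PROVED (`PositiveTemperatureNoPairLRO_holds`) by
assembling the tree's discharges.

## Mathlib / tree search

Tree: hubbard.S11 facts and proofs (above; `koma_tasaki_1d_holds` is the one-dimensional
exponential-decay companion, not part of this headline); `QLattice.HasTorusLRO` (`LatticeTori.lean`);
`Barriers/HubbardSuperconductivity/LROForcesLowLyingStates.lean` (the `T = 0` companion:
LRO ⇒ low-lying states). Related but distinct: the Heisenberg-model facts `Literature.MathematicalPhysics.QuantumLattice.mermin_wagner`,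
`mermin_wagner_staggered`, `mermin_wagner_magnetisation`, `mermin_wagner_general`
(`Literature/MathematicalPhysics/QuantumLattice/HeisenbergOrder.lean`) and the sibling barrier
`Literature/Barriers/AtomisticToContinuum/HohenbergLowDimension.lean` (the `Hohenberg1967` entry);
neither covers itinerant electrons — Koma–Tasaki is the Hubbard-model version and is what is used.

## Barrier audit (2026-08-15): reach, edge and witness

Appended (nothing above is restated or changed, except the corrected `scope_caveats:` of the
BARRIER block): (i) `not_hasTorusLRO_of_abs_le_rpow_schedule` — the summation lemma with a
side-dependent exponent (`f_L log L → ∞` suffices); (ii) `not_hasTorusLRO_thermal_of_schedule` —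
no pair and no transverse-spin torus LRO of the Hubbard Gibbs states along ANY temperature
schedule with `β_L|t| = o(log L)` (explicit bounds `e (dist + 1)^{-1/(128β|t|+1)}` of
`HubbardHubbardModelKomaTasakiProofs`); (iii) `one_le_komaTasakiBound_of_log_le` — the edge: for
`log(L + 1) ≤ 128β|t| + 1` that bound is implied by `|⟨A⟩| ≤ ‖A‖ ≤ 1`; (iv) the narrowed block
`PositiveTemperatureNoPairLRONarrow` (three conjuncts, proved) re-reading the technique-class
tokens; (v) section Witness — `xy_gibbs_evenTorusLRO_of_schedule` (quantum XY, every spin,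
every `d ≥ 2`: Gibbs-state LRO along any schedule `β_L ≥ β₀(1 + T_L)`, from the tree's
Dyson–Lieb–Simon / Kennedy–Lieb–Shastry inputs and `kls_thermal_ineq7`),
`torusGreen_zero_two_le` (`T_L ≤ (1 + log L)²` on `(ℤ/Lℤ)²`) and
`xy_gibbs_evenTorusLRO_two_polylog` (LRO of the two-dimensional XY Gibbs states along
`β_L = β₀(1 + (1 + log L)²)`): positive-temperature two-point long-range order of a
`U(1)`-breaking order parameter in two dimensions, beyond the edge of the obstruction.

## References

* T. Koma, H. Tasaki, PRL 68 (1992) 3248–3251, Theorem (2)–(4), Corollary discussion p. 3,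
  footnotes [9]–[11].
* T. Kennedy, E. H. Lieb, B. S. Shastry, PRL 61 (1988) 2582–2584 (`KLS1988PRL`, Theorem and
  eqs. (3)–(8); cite-only, acq-00190; read through the tree's `XYOrderThermalProofs.lean`).
* F. J. Dyson, E. H. Lieb, B. Simon, J. Stat. Phys. 18 (1978) 335–383 (`DysonLiebSimon1978`,
  Thms. 4.2, 5.1; as cited in KLS1988PRL and formalized in the tree's XY files).
* T. Paiva, R. R. dos Santos, R. T. Scalettar, P. J. H. Denteneer, PRB 69 (2004) 184501
  = arXiv:cond-mat/0403397 (`PaivaEtAl2004`, held), pp. 2–4: BKT transition of the attractive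
  2D Hubbard model, helicity modulus `ρ_s = ¼[Λ^L - Λ^T]`, universal jump `T_c = (π/2)ρ_s⁻`.
* D. R. Nelson, J. M. Kosterlitz, PRL 39 (1977) 1201 (`NelsonKosterlitz1977`, title claim).
* R. M. Fernandes, P. P. Orth, J. Schmalian, Ann. Rev. CMP 10 (2019) 133 = arXiv:1804.00818
  (`FernandesOrthSchmalian2019`, held), arXiv pp. 8 and 10: Ising-like vestigial order at
  `T > 0` in `d = 2` where the primary order is forbidden by Hohenberg–Mermin–Wagner.
* D. K. Ghosh, PRL 27 (1971) 1584 (`Ghosh1971`; cited through KomaTasakiPRL1992 ref. [4]).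
* O. McBryan, T. Spencer, CMP 53 (1977) 299 (`McBryanSpencer1977`; KT ref. [5]).
* P. C. Hohenberg, Phys. Rev. 158 (1967) 383 (`Hohenberg1967`: the superfluid/superconductor
  original of the `d ≤ 2`, `T > 0` no-go).
-/

noncomputable section

namespace Literature.Barriers.HubbardSuperconductivity

open Literature.MathematicalPhysics.QuantumLattice

/-- **BARRIER `PositiveTemperatureNoPairLRO` (Koma–Tasaki 1992; Hohenberg–Mermin–Wagner for
itinerant electrons) — PROVED.** For the Hubbard model on the two-dimensional tori `(ℤ/Lℤ)²` with
any hopping `t`, interaction `U`, chemical potential `μ` and any inverse temperature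
`0 < β < ∞`: (a) the thermal on-site pair correlation obeys
`|⟨c†_{x↑} c†_{x↓} c_{y↓} c_{y↑}⟩_{β,L}| ≤ C (dist(x, y) + 1)^{-f}`, `f = f(β|t|) > 0`, uniformly
in `L` (`koma_tasaki_2d`, KT Theorem (2)); (b) consequently neither the pair two-point function
nor the transverse spin two-point function of the Gibbs state has long-range order,
`¬ HasTorusLRO (thermalPairCorr β t U μ)` and `¬ HasTorusLRO (thermalSpinCorr β t U μ)`
(`koma_tasaki_noLRO`, KT p. 3). Both conjuncts are theorems of the tree; assembled in
`PositiveTemperatureNoPairLRO_holds`.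

technique_class: positive-temperature-methods Gibbs-state-LRO finite-temperature-phase-transition-to-SC-LRO-in-2D thermal-order-parameter finite-T-numerics-read-as-LRO
blocks: the finite-temperature strengthening of `HubbardSuperconductivity` — superconducting long-range order of the 2D Hubbard Gibbs state at some `T > 0` (for the on-site singlet pair as printed and proved; for "any kind of condensation which is related to a spontaneous breakdown of the … global `U(1)` symmetry", hence the `d_{x²-y²}` pair field, by the printed remark) is FALSE for every `t, U, μ, β < ∞` [cite: KomaTasakiPRL1992, Theorem (2) and p. 3]; hence no route to the summit can pass through "pair LRO at some `T > 0`, then `T → 0`", and a positive-temperature order parameter or finite-`T` pair correlations saturating to a constant cannot be the object proved; the same holds for (transverse) magnetic order [cite: KomaTasakiPRL1992, Theorem (4)] [cite: Ghosh1971, main theorem (as cited in KomaTasakiPRL1992, ref. [4])] — this is why the summit is posed for GROUND STATES.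
because: the global `U(1)` phase symmetry allows a McBryan–Spencer complex rotation [cite: McBryanSpencer1977, main theorem (as cited in KomaTasakiPRL1992, ref. [5])]: the non-unitary gauge transformation `G = exp[-Σ_u φ_u n_u]` multiplies the pair operator by `e^{-2(φ_x - φ_y)}` and perturbs the hopping term by `O(β|t| Σ_{⟨uv⟩}(cosh(φ_u - φ_v) - 1))` in the exponent, so `|⟨c†c†cc⟩_β| ≤ e^{-2(φ_x-φ_y)} e^{β|t| Σ 2(cosh ∇φ - 1)}`; a logarithmic `φ` gives `|x - y|^{-α f(β)}` with `f(β) ≈ 1/β` in `d = 2` (exponential decay in `d = 1`), for ARBITRARY interactions `V({n_{xσ}})` [cite: KomaTasakiPRL1992, eqs. (5)–(12) and Theorem]; summing the power law over the torus, `Σ_y (dist(x,y)+1)^{-f} = o(L²)`, kills `liminf L⁻⁴ Σ_{x,y} G_L(x,y) > 0` (tree: `koma_tasaki_noLRO_of`).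
evasions_known: (i) zero temperature: the decay exponent `α f(β) ∝ β⁻¹` vanishes as `β → ∞`, so ground states are unconstrained [cite: KomaTasakiPRL1992, p. 3 ("the power indices … are proportional to `β⁻¹` at low temperatures")] — the summit `HubbardSuperconductivity` is posed at `T = 0` (with `LROForcesLowLyingStates.lean` as the `T = 0` companion obstruction); (ii) quasi-long-range order: power-law decay is permitted, "the slowest possible decay in these models is of the Kosterlitz-Thouless type" [cite: KomaTasakiPRL1992, p. 3], so a Berezinskii–Kosterlitz–Thouless superconducting phase with algebraic pair correlations at `0 < T < T_BKT` is compatible and is what finite-temperature numerics target ("It is well known by Mermin-Wagner's theorem that no off-diagonal long range order takes place at finite temperature in purely two-dimensional (2D) systems. In the case of pure 2D, superconducting transition is expected to be of the Kosterlitz-Thouless (KT) type" — AFQMC for the ATTRACTIVE Hubbard model on a triangular lattice) [cite: NakanoKuroki2006, §I p. 2]; (iii) three dimensions or interlayer coupling lie outside the theorem's `d ≤ 2` hypothesis [cite: KomaTasakiPRL1992, Theorem]; none of (i)–(iii) yields LRO at `T > 0` in `d = 2`.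
scope_caveats: the printed Theorem (2) — and the tree's proof `koma_tasaki_2d_holds` — concern the ON-SITE singlet pair `c†_{x↑}c†_{x↓}` (and (3) single electrons, (4) transverse spins under `z`-directed fields); the extension to general `U(1)`-breaking order parameters such as the summit's bond pair field `Σ_e g_d(e) c_{x↑} c_{x+e,↓}` is printed as "our method can be easily extended" and as footnote [10], not as a displayed theorem; it is PROVED in the tree in the sibling entry `HohenbergMerminWagnerPairing` (`not_hasTorusLRO_thermal_dWave`, every finite-range singlet pair field `localPair g`), not in this file [cite: KomaTasakiPRL1992, p. 3 and footnote [10]]; positive temperature only (Gibbs states; the tree's facts are grand-canonical on tori, KT's canonical at fixed density, "Our result is independent of `ρ` and thus applies to grand canonical averages as well" [cite: KomaTasakiPRL1992, p. 2]); nothing is asserted at `T = 0`, where the summit lives; the tree's constants (`f = (2+B)/(1+B)²`, `B = 128β|t|`) are far from optimal, as are the printed ones ("certainly not optimal at high temperatures") [cite: KomaTasakiPRL1992, p. 3]; longitudinal (`S^z`) magnetic order under `z`-fields is not covered by (4); (barrier audit 2026-08-15, see `PositiveTemperatureNoPairLRONarrow` below) every token of `technique_class` above is to be read "two-point long-range order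 of a `U(1)`-charged (resp. transverse-spin) local observable in Gibbs states at an `L`-INDEPENDENT `β` — or, by the narrowed theorem, along any temperature schedule with `β_L|t| = o(log L)`": NOT covered, although matched by the words "positive-temperature-methods", "Gibbs-state-LRO", "thermal-order-parameter", are (α) schedules `β_L ≥ log(L + 1)/(128|t|)` (ground-state proxies `β_L ≍ L^z`, "`β = L`" numerics), where the bound is void, (β) positive-temperature infrared bounds continued to `T = 0` at fixed volume (Kennedy–Lieb–Shastry; tree: `kennedy_lieb_shastry_xy_ground_holds`), (γ) fixed-`β` certificates other than two-point LRO — algebraic lower bounds, susceptibilities, the helicity modulus / superfluid stiffness and the BKT `T_c = (π/2)ρ_s⁻` [cite: PaivaEtAl2004, pp. 2–4] — and (δ) charge-neutral (vestigial, Ising-like) composites of pairs, which may have true LRO at `T > 0` in `d = 2` [cite: FernandesOrthSchmalian2019, arXiv pp. 8 and 10].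
status: established (theorem [cite: KomaTasakiPRL1992, Theorem and p. 3]; PROVED in the tree: `Literature.MathematicalPhysics.QuantumLattice.koma_tasaki_2d_holds`, `koma_tasaki_magnetic_holds`, `koma_tasaki_1d_holds`, `koma_tasaki_noLRO_of`, assembled below)
[cite: KomaTasakiPRL1992, Theorem (2), (4) and p. 3] -/
def PositiveTemperatureNoPairLRO : Prop :=
  koma_tasaki_2d ∧ koma_tasaki_noLRO

/-- **The barrier is a theorem** (assembly of the tree's discharges of hubbard.S11).
[cite: KomaTasakiPRL1992, Theorem (2) and p. 3] -/
theorem PositiveTemperatureNoPairLRO_holds : PositiveTemperatureNoPairLRO :=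
  ⟨koma_tasaki_2d_holds, koma_tasaki_noLRO_of koma_tasaki_2d_holds koma_tasaki_magnetic_holds⟩

/-- Unfolding lemma. [cite: KomaTasakiPRL1992, Theorem] -/
theorem positiveTemperatureNoPairLRO_iff :
    PositiveTemperatureNoPairLRO ↔ koma_tasaki_2d ∧ koma_tasaki_noLRO :=
  Iff.rfl

/-- **No thermal pair long-range order at any `T > 0` in `d = 2`** (the superconducting half of
the corollary, for users): for all `t, U, μ` and `β > 0`,
`¬ HasTorusLRO (thermalPairCorr β t U μ)` on `(ℤ/Lℤ)²`. [cite: KomaTasakiPRL1992, p. 3] -/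
theorem PositiveTemperatureNoPairLRO.not_pairLRO (t U μ β : ℝ) (hβ : 0 < β) :
    ¬ HasTorusLRO (thermalPairCorr (d := 2) β t U μ) :=
  (PositiveTemperatureNoPairLRO_holds.2 t U μ β hβ).1

/-- **No thermal transverse magnetic long-range order at any `T > 0` in `d = 2`** (the magnetic
half). (Names chosen not to collide with `Literature.MathematicalPhysics.QuantumLattice.not_hasTorusLRO_thermalPairCorr` /
`_thermalSpinCorr` of `HubbardHubbardModelProofs.lean`, which have a different, conditional
signature.) [cite: KomaTasakiPRL1992, Theorem (4) and p. 3] -/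
theorem PositiveTemperatureNoPairLRO.not_spinLRO (t U μ β : ℝ) (hβ : 0 < β) :
    ¬ HasTorusLRO (thermalSpinCorr (d := 2) β t U μ) :=
  (PositiveTemperatureNoPairLRO_holds.2 t U μ β hβ).2

end Literature.Barriers.HubbardSuperconductivity

/-! ### Witness (barrier audit 2026-08-15): beyond the edge the window is populated — Gibbs-state long-range order along temperature schedules in the two-dimensional quantum XY model

The Koma–Tasaki mechanism is void for `β_L ≳ log L` (`PositiveTemperatureNoPairLRONarrow`,
conjunct (3), below). That this is not an artefact of the constants: in a reflection-positive
`U(1)`-symmetric model — the quantum XY model, whose transverse correlations obey the same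
McBryan–Spencer bound at every fixed `β` [cite: KomaTasakiPRL1992, footnote [11]] — the Gibbs
states DO have long-range order along polylogarithmic schedules in `d = 2`. Everything below is
proved from the tree's Dyson–Lieb–Simon / Kennedy–Lieb–Shastry development
(`XYOrderThermalProofs.lean` and its inputs, all valid for `d ≥ 1` or `d ≥ 2`); the only new
analysis is the elementary bound `T_L ≤ (1 + log L)²` for the two-dimensional torus Green
function mean. For the Hubbard model the missing ingredient on this line is reflection
positivity (lost for hopping fermions in `d ≥ 2`), not Hohenberg–Mermin–Wagner. -/

namespace Literature.Barriers.HubbardSuperconductivity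

section Witness

open Filter Topology Matrix Finset
open Literature.MathematicalPhysics.QuantumLattice Literature.Probability.LatticeModels
  Literature.Probability.Percolation Literature.MathematicalPhysics.QuantumLattice.XYOrderProofs
  Literature.Barriers.AtomisticToContinuum.BoseGas
open scoped BigOperators


/-! #### The torus Green function mean in two dimensions -/

variable {L : ℕ} [NeZero L]

/-- Jordan's bound per coordinate: `8 mᵢ²/L² ≤ 1 - cos (p_k)ᵢ`, `mᵢ = valMinAbs (k i)`. [folklore] -/
theorem eight_mul_valMinAbs_sq_div_le (k : TorusSite 2 L) (i : Fin 2) :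
    8 * ((k i).valMinAbs : ℝ) ^ 2 / (L : ℝ) ^ 2 ≤ 1 - Real.cos (latticeMomentum L k i) := by
  have hL : (0 : ℝ) < L := by exact_mod_cast Nat.pos_of_ne_zero (NeZero.ne L)
  rw [cos_latticeMomentum_eq_cos_valMinAbs]
  have hb := valMinAbs_bounds L (k i)
  have hθ : |2 * Real.pi / L * ((k i).valMinAbs : ℝ)| ≤ Real.pi := by
    rw [abs_le]
    constructor
    · rw [div_mul_eq_mul_div, le_div_iff₀ hL]
      nlinarith [Real.pi_pos, hb.1]
    · rw [div_mul_eq_mul_div, div_le_iff₀ hL]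
      nlinarith [Real.pi_pos, hb.2]
  have hj := Real.cos_le_one_sub_mul_cos_sq hθ
  have heq : 2 / Real.pi ^ 2 * (2 * Real.pi / L * ((k i).valMinAbs : ℝ)) ^ 2 =
      8 * ((k i).valMinAbs : ℝ) ^ 2 / (L : ℝ) ^ 2 := by
    field_simp
    ring
  rw [← heq]
  linarith

/-- The dispersion on the dual torus of `(ℤ/Lℤ)²` is at least `8(m₀² + m₁²)/L²`. [folklore] -/
theorem valMinAbs_sq_le_dispersion_two (k : TorusSite 2 L) :
    8 * (((k 0).valMinAbs : ℝ) ^ 2 + ((k 1).valMinAbs : ℝ) ^ 2) / (L : ℝ) ^ 2 ≤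
      dispersion (latticeMomentum L k) := by
  have h0 := eight_mul_valMinAbs_sq_div_le k 0
  have h1 := eight_mul_valMinAbs_sq_div_le k 1
  unfold dispersion
  rw [Fin.sum_univ_two]
  have h : 8 * (((k 0).valMinAbs : ℝ) ^ 2 + ((k 1).valMinAbs : ℝ) ^ 2) / (L : ℝ) ^ 2 =
      8 * ((k 0).valMinAbs : ℝ) ^ 2 / (L : ℝ) ^ 2 +
        8 * ((k 1).valMinAbs : ℝ) ^ 2 / (L : ℝ) ^ 2 := by
    ring
  rw [h]
  exact add_le_add h0 h1

/-- For `k ≠ 0` on the dual torus of `(ℤ/Lℤ)²`: `1/ε(p_k) ≤ (L²/8) (m₀² + m₁²)⁻¹`. [folklore] -/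
theorem inv_dispersion_two_le {k : TorusSite 2 L} (hk : k ≠ 0) :
    1 / dispersion (latticeMomentum L k) ≤
      (L : ℝ) ^ 2 / 8 * (1 / (((k 0).valMinAbs : ℝ) ^ 2 + ((k 1).valMinAbs : ℝ) ^ 2)) := by
  have hL : (0 : ℝ) < L := by exact_mod_cast Nat.pos_of_ne_zero (NeZero.ne L)
  have hne : ((k 0).valMinAbs : ℝ) ^ 2 + ((k 1).valMinAbs : ℝ) ^ 2 ≠ 0 := by
    intro hA
    have hs0 := sq_nonneg ((k 0).valMinAbs : ℝ)
    have hs1 := sq_nonneg ((k 1).valMinAbs : ℝ)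
    have h0 : ((k 0).valMinAbs : ℝ) ^ 2 = 0 := by linarith
    have h1 : ((k 1).valMinAbs : ℝ) ^ 2 = 0 := by linarith
    have h0' : ((k 0).valMinAbs : ℝ) = 0 := pow_eq_zero_iff two_ne_zero |>.1 h0
    have h1' : ((k 1).valMinAbs : ℝ) = 0 := pow_eq_zero_iff two_ne_zero |>.1 h1
    have h0z : (k 0).valMinAbs = 0 := by exact_mod_cast h0'
    have h1z : (k 1).valMinAbs = 0 := by exact_mod_cast h1'
    apply hk
    funext i
    fin_cases i
    · exact (ZMod.valMinAbs_eq_zero (k 0)).1 h0z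
    · exact (ZMod.valMinAbs_eq_zero (k 1)).1 h1z
  have hm : 0 < ((k 0).valMinAbs : ℝ) ^ 2 + ((k 1).valMinAbs : ℝ) ^ 2 :=
    lt_of_le_of_ne (by positivity) (Ne.symm hne)
  have hdpos : 0 < 8 * (((k 0).valMinAbs : ℝ) ^ 2 + ((k 1).valMinAbs : ℝ) ^ 2) / (L : ℝ) ^ 2 := by
    positivity
  calc 1 / dispersion (latticeMomentum L k)
      ≤ 1 / (8 * (((k 0).valMinAbs : ℝ) ^ 2 + ((k 1).valMinAbs : ℝ) ^ 2) / (L : ℝ) ^ 2) :=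
        one_div_le_one_div_of_le hdpos (valMinAbs_sq_le_dispersion_two k)
    _ = (L : ℝ) ^ 2 / 8 * (1 / (((k 0).valMinAbs : ℝ) ^ 2 + ((k 1).valMinAbs : ℝ) ^ 2)) := by
        field_simp

omit [NeZero L] in
/-- `|valMinAbs a| ≥ 1` for `a ≠ 0`. [folklore] -/
theorem one_le_abs_valMinAbs_cast {a : ZMod L} (ha : a ≠ 0) : (1 : ℝ) ≤ |(a.valMinAbs : ℝ)| := by
  have hz : a.valMinAbs ≠ 0 := fun h => ha ((ZMod.valMinAbs_eq_zero a).1 h)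
  have h1 : (1 : ℤ) ≤ |a.valMinAbs| := Int.one_le_abs hz
  have h2 : ((1 : ℤ) : ℝ) ≤ ((|a.valMinAbs| : ℤ) : ℝ) := by exact_mod_cast h1
  rw [Int.cast_abs] at h2
  exact_mod_cast h2

/-- The elementary lattice sum behind the two-dimensional Green function:
`Σ_{a,b ∈ ℤ_L} (m_a² + m_b²)⁻¹ ≤ W² + 2W` with `W = Σ_a |m_a|⁻¹` (the origin contributes
`1/0 = 0`). [folklore] -/
theorem sum_sum_inv_sq_add_sq_le :
    ∑ a : ZMod L, ∑ b : ZMod L, 1 / (((a.valMinAbs : ℝ)) ^ 2 + ((b.valMinAbs : ℝ)) ^ 2) ≤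
      (∑ a : ZMod L, 1 / |(a.valMinAbs : ℝ)|) ^ 2 + 2 * ∑ a : ZMod L, 1 / |(a.valMinAbs : ℝ)| := by
  classical
  set w : ZMod L → ℝ := fun a => 1 / |(a.valMinAbs : ℝ)| with hw
  set δ : ZMod L → ℝ := fun a => if a = 0 then 1 else 0 with hδ
  have hwz : w 0 = 0 := by simp [hw]
  have hδz : δ 0 = 1 := by simp [hδ]
  have hδnz : ∀ {b : ZMod L}, b ≠ 0 → δ b = 0 := fun hb => by simp [hδ, hb]
  have hv0 : (((0 : ZMod L).valMinAbs : ℝ)) = 0 := by simp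
  -- the pointwise bound
  have hpt : ∀ a b : ZMod L,
      1 / (((a.valMinAbs : ℝ)) ^ 2 + ((b.valMinAbs : ℝ)) ^ 2) ≤
        w a * w b + w a * δ b + δ a * w b := by
    intro a b
    by_cases ha : a = 0
    · subst ha
      by_cases hb : b = 0
      · subst hb
        rw [hv0, hwz, hδz]
        norm_num
      · have hb1 := one_le_abs_valMinAbs_cast hb
        have hbpos : 0 < |(b.valMinAbs : ℝ)| := by linarith
        rw [hv0, hwz, hδz, hδnz hb]
        have hle : 1 / (((0 : ℝ)) ^ 2 + ((b.valMinAbs : ℝ)) ^ 2) ≤ w b := by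
          simp only [hw]
          refine one_div_le_one_div_of_le hbpos ?_
          nlinarith [sq_abs (b.valMinAbs : ℝ)]
        linarith
    · by_cases hb : b = 0
      · subst hb
        have ha1 := one_le_abs_valMinAbs_cast ha
        have hapos : 0 < |(a.valMinAbs : ℝ)| := by linarith
        rw [hv0, hwz, hδz, hδnz ha]
        have hle : 1 / (((a.valMinAbs : ℝ)) ^ 2 + ((0 : ℝ)) ^ 2) ≤ w a := by
          simp only [hw]
          refine one_div_le_one_div_of_le hapos ?_
          nlinarith [sq_abs (a.valMinAbs : ℝ)]
        linarith
      · have ha1 := one_le_abs_valMinAbs_cast ha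
        have hb1 := one_le_abs_valMinAbs_cast hb
        rw [hδnz ha, hδnz hb, mul_zero, zero_mul, add_zero, add_zero]
        simp only [hw]
        rw [one_div_mul_one_div]
        refine one_div_le_one_div_of_le (by positivity) ?_
        nlinarith [sq_abs (a.valMinAbs : ℝ), sq_abs (b.valMinAbs : ℝ),
          sq_nonneg (|(a.valMinAbs : ℝ)| - |(b.valMinAbs : ℝ)|)]
  -- summing
  have hD : ∑ a : ZMod L, δ a = 1 := by simp [hδ, Finset.sum_ite_eq']
  calc ∑ a : ZMod L, ∑ b : ZMod L, 1 / (((a.valMinAbs : ℝ)) ^ 2 + ((b.valMinAbs : ℝ)) ^ 2)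
      ≤ ∑ a : ZMod L, ∑ b : ZMod L, (w a * w b + w a * δ b + δ a * w b) :=
        sum_le_sum fun a _ => sum_le_sum fun b _ => hpt a b
    _ = (∑ a, w a) * (∑ b, w b) + (∑ a, w a) * (∑ b, δ b) + (∑ a, δ a) * (∑ b, w b) := by
        simp only [sum_add_distrib, Finset.sum_mul_sum]
    _ = (∑ a : ZMod L, 1 / |(a.valMinAbs : ℝ)|) ^ 2 +
          2 * ∑ a : ZMod L, 1 / |(a.valMinAbs : ℝ)| := by
        rw [hD, sq]
        ring

/-- **`T_L ≤ (1 + log L)²` on `(ℤ/Lℤ)²`**: the torus Green function mean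
`T_L = L⁻² Σ_{p≠0} E_p⁻¹` (`torusGreen 0`) grows at most like `log² L` in two dimensions (the
classical asymptotics is `T_L ∼ (1/π) log L`; the cruder square suffices here). From
`1/E_p ≤ (L²/8)(m₀² + m₁²)⁻¹` (Jordan) and `Σ_{a≠0} |m_a|⁻¹ ≤ 2(1 + log L)`
(`sum_inv_abs_valMinAbs_le`). [folklore] -/
theorem torusGreen_zero_two_le (L : ℕ) [NeZero L] :
    torusGreen (0 : TorusSite 2 L) ≤ (1 + Real.log L) ^ 2 := by
  classical
  have hL : (0 : ℝ) < L := by exact_mod_cast Nat.pos_of_ne_zero (NeZero.ne L)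
  have hlog : 0 ≤ Real.log L := Real.log_nonneg (by exact_mod_cast NeZero.one_le)
  set W : ℝ := ∑ a : ZMod L, 1 / |(a.valMinAbs : ℝ)| with hW
  have hWeq : W = ∑ a ∈ (univ : Finset (ZMod L)).erase 0, 1 / |(a.valMinAbs : ℝ)| := by
    rw [hW, ← Finset.add_sum_erase _ _ (mem_univ (0 : ZMod L))]
    simp
  have hWle : W ≤ 2 * (1 + Real.log L) := by
    rw [hWeq]
    exact sum_inv_abs_valMinAbs_le L
  have hW0 : 0 ≤ W := sum_nonneg fun a _ => by positivity
  -- the momentum sum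
  have hsum : ∑ k ∈ (univ : Finset (TorusSite 2 L)).erase 0, 1 / dispersion (latticeMomentum L k) ≤
      (L : ℝ) ^ 2 / 8 * ∑ k : TorusSite 2 L,
        1 / (((k 0).valMinAbs : ℝ) ^ 2 + ((k 1).valMinAbs : ℝ) ^ 2) := by
    calc ∑ k ∈ (univ : Finset (TorusSite 2 L)).erase 0, 1 / dispersion (latticeMomentum L k)
        ≤ ∑ k ∈ (univ : Finset (TorusSite 2 L)).erase 0,
            (L : ℝ) ^ 2 / 8 * (1 / (((k 0).valMinAbs : ℝ) ^ 2 + ((k 1).valMinAbs : ℝ) ^ 2)) :=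
          sum_le_sum fun k hk => inv_dispersion_two_le (mem_erase.1 hk).1
      _ ≤ ∑ k : TorusSite 2 L,
            (L : ℝ) ^ 2 / 8 * (1 / (((k 0).valMinAbs : ℝ) ^ 2 + ((k 1).valMinAbs : ℝ) ^ 2)) :=
          sum_le_sum_of_subset_of_nonneg (erase_subset _ _) fun k _ _ => by positivity
      _ = (L : ℝ) ^ 2 / 8 * ∑ k : TorusSite 2 L,
            1 / (((k 0).valMinAbs : ℝ) ^ 2 + ((k 1).valMinAbs : ℝ) ^ 2) := by rw [← mul_sum]
  have hpair : ∑ k : TorusSite 2 L, 1 / (((k 0).valMinAbs : ℝ) ^ 2 + ((k 1).valMinAbs : ℝ) ^ 2) =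
      ∑ a : ZMod L, ∑ b : ZMod L, 1 / (((a.valMinAbs : ℝ)) ^ 2 + ((b.valMinAbs : ℝ)) ^ 2) := by
    rw [← Fintype.sum_prod_type']
    exact Fintype.sum_equiv (finTwoArrowEquiv _) _ _ (fun k => rfl)
  have hS := sum_sum_inv_sq_add_sq_le (L := L)
  rw [torusGreen_zero_eq, div_le_iff₀ (by positivity)]
  calc ∑ k ∈ (univ : Finset (TorusSite 2 L)).erase 0, 1 / dispersion (latticeMomentum L k)
      ≤ (L : ℝ) ^ 2 / 8 * (W ^ 2 + 2 * W) := by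
        refine hsum.trans ?_
        rw [hpair]
        exact mul_le_mul_of_nonneg_left hS (by positivity)
    _ ≤ (L : ℝ) ^ 2 / 8 * ((2 * (1 + Real.log L)) ^ 2 + 2 * (2 * (1 + Real.log L))) := by
        gcongr
    _ ≤ (1 + Real.log L) ^ 2 * (L : ℝ) ^ 2 := by
        nlinarith [hlog, sq_nonneg (Real.log L), hL]




variable {d : ℕ}
set_option maxHeartbeats 400000 in -- buildfix (bf3-g26): 160k/180k FAIL, 200k PASS at accept time; line-neutral budget line
/-- **The Kennedy–Lieb–Shastry margin along a temperature schedule** (every `d ≥ 2`). The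
analytic endgame of `kennedy_lieb_shastry_xy_thermal_holds` (`kls_thermal_margin`, `d ≥ 3`,
fixed `β ≥ β₀`) with the thermal term absorbed by the schedule instead of by the dimension: if
`β_k ≥ β₀ (1 + T_{2k})`, `T_L = torusGreen 0 = L^{-d} Σ_{p≠0} E_p⁻¹`, then
`T_{2k}/(2β_k) ≤ 1/(2β₀)` and the margin `c = 2(s - ½√s ρ) > 0` of the ground-state theorem
survives (`β₀ = 16ℓ + 1 + 4(ℓ + ½)/c`, `ℓ = log(n+1)/(2d)`). No hypothesis `d ≥ 3`: the only use of
the dimension in `kls_thermal_margin` was `T_L → c_d < ∞`. [cite: KLS1988PRL, Theorem and eqs. (7)–(8)]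
[cite: DysonLiebSimon1978, Thm. 5.1 (as cited in KLS1988PRL, ref. 1)] -/
theorem kls_thermal_margin_schedule (hd : 2 ≤ d) {n : ℕ} (hn : 1 ≤ n) :
    ∃ β₀ : ℝ, 0 < β₀ ∧ ∀ β : ℕ → ℝ, ∀ a : ℕ → ℝ,
      (∀ k, a k ≤ 2 * ((n : ℝ) / 2) ^ 2) →
      (∀ᶠ k : ℕ in atTop, ∀ [NeZero (2 * k)],
          β₀ * (1 + torusGreen (0 : TorusSite d (2 * k))) ≤ β k ∧
          ∃ e g : ℝ, a k = 2 * g ∧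
            e ≤ g + 1 / 2 * Real.sqrt e * klsRiemannSum d (2 * k) +
              1 / (2 * β k) * torusGreen (0 : TorusSite d (2 * k)) ∧
            ((n : ℝ) / 2) ^ 2 / 2 - Real.log ((n : ℝ) + 1) / (2 * d * β k) ≤ e) →
      0 < liminf a atTop := by
  have hd0 : (0 : ℝ) < d := by exact_mod_cast (show 0 < d by omega)
  -- the eventual bound on the KLS Riemann sums
  obtain ⟨ρ, hρlt, hρev⟩ := klsRiemannSum_eventually_le d hd
  set ρ' : ℝ := max ρ 0 with hρ'_def
  have hρ'0 : 0 ≤ ρ' := le_max_right _ _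
  have hρ'lt : ρ' < Real.sqrt 2 / 2 := max_lt hρlt (by positivity)
  have h2pos : (0 : ℝ) < Real.sqrt 2 := by positivity
  have h22 : Real.sqrt 2 * Real.sqrt 2 = 2 := Real.mul_self_sqrt (by norm_num)
  have hsqrt2 : Real.sqrt 2 < 2 := by
    rw [Real.sqrt_lt' (by norm_num)]; norm_num
  -- the spin constant `s = ½ S²` and its root
  set s : ℝ := ((n : ℝ) / 2) ^ 2 / 2 with hs_def
  have hn1 : (1 : ℝ) ≤ n := by exact_mod_cast hn
  have hs8 : 1 / 8 ≤ s := by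
    rw [hs_def]
    nlinarith
  have hs0 : 0 ≤ s := by linarith
  have hsq : Real.sqrt s = n * Real.sqrt 2 / 4 := by
    have h2 : s = (n * Real.sqrt 2 / 4) ^ 2 := by
      rw [hs_def, div_pow, div_pow, mul_pow, Real.sq_sqrt (by norm_num : (0 : ℝ) ≤ 2)]
      ring
    rw [h2, Real.sqrt_sq (by positivity)]
  have hss : Real.sqrt 2 / 4 ≤ Real.sqrt s := by
    rw [hsq]
    nlinarith
  -- the zero-temperature margin `c = 2(s - ½√s ρ') > 0`
  set c : ℝ := 2 * (s - 1 / 2 * Real.sqrt s * ρ') with hc_def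
  have hc : 0 < c := by
    have h1 : Real.sqrt s * Real.sqrt s = s := Real.mul_self_sqrt hs0
    have h3 : 0 < Real.sqrt s - ρ' / 2 := by linarith
    have h4 : s - 1 / 2 * Real.sqrt s * ρ' = Real.sqrt s * (Real.sqrt s - ρ' / 2) := by
      rw [mul_sub, h1]; ring
    rw [hc_def, h4]
    exact mul_pos two_pos (mul_pos (lt_of_lt_of_le (by positivity) hss) h3)
  -- the entropy constant and the threshold `β₀` (the thermal term is absorbed by the schedule)
  set ℓ : ℝ := Real.log ((n : ℝ) + 1) / (2 * d) with hℓ_def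
  have hℓ0 : 0 ≤ ℓ := by
    rw [hℓ_def]
    exact div_nonneg (Real.log_nonneg (by linarith)) (by positivity)
  set β₀ : ℝ := 16 * ℓ + 1 + 4 * (ℓ + 1 / 2) / c with hβ₀_def
  have hβ₀pos : 0 < β₀ := by rw [hβ₀_def]; positivity
  have hβ₀ne : β₀ ≠ 0 := hβ₀pos.ne'
  refine ⟨β₀, hβ₀pos, fun β a hbd hev => ?_⟩
  -- eventually `R_{2k} ≤ ρ'`
  have h2k : Tendsto (fun k : ℕ => 2 * k) atTop atTop :=
    tendsto_atTop_atTop.2 fun b => ⟨b, fun k hk => by omega⟩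
  have hRk : ∀ᶠ k : ℕ in atTop, klsRiemannSum d (2 * k) ≤ ρ' :=
    (h2k.eventually hρev).mono fun k hk => hk.trans (le_max_left _ _)
  -- eventually the sequence is `≥ c/2`
  have hev' : ∀ᶠ k : ℕ in atTop, c / 2 ≤ a k := by
    filter_upwards [hRk, hev, eventually_ge_atTop 1] with k hk hevk hk1
    haveI : NeZero (2 * k) := ⟨by omega⟩
    obtain ⟨hβk, e, g, hag, h7, hDk⟩ := hevk
    set R := klsRiemannSum d (2 * k) with hR_def
    set T := torusGreen (0 : TorusSite d (2 * k)) with hT_def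
    have hR0 : 0 ≤ R := klsRiemannSum_nonneg _ _
    have hT0 : 0 ≤ T := torusGreen_zero_nonneg (d := d) (2 * k)
    -- the schedule: `β₀ ≤ β₀ (1 + T) ≤ β_k`
    have hβk0 : β₀ ≤ β k := by nlinarith
    have hβpos : 0 < β k := hβ₀pos.trans_le hβk0
    have hβ16 : 16 * ℓ ≤ β k := by
      have : (0 : ℝ) ≤ 4 * (ℓ + 1 / 2) / c := by positivity
      linarith
    -- consequences: `ℓ/β_k ≤ 1/16` and `ℓ/β_k + T/(2β_k) ≤ c/4`
    have hℓβ : ℓ / β k ≤ 1 / 16 := by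
      rw [div_le_iff₀ hβpos]; linarith
    have hℓβk : ℓ / β k ≤ ℓ / β₀ := div_le_div_of_nonneg_left hℓ0 hβ₀pos hβk0
    have hTβk : T / (2 * β k) ≤ 1 / (2 * β₀) := by
      rw [div_le_div_iff₀ (by positivity) (by positivity)]
      nlinarith
    have hτβ : ℓ / β k + T / (2 * β k) ≤ c / 4 := by
      have h2 : (ℓ + 1 / 2) / β₀ ≤ c / 4 := by
        rw [div_le_div_iff₀ hβ₀pos (by norm_num)]
        have h3 : 4 * (ℓ + 1 / 2) / c ≤ β₀ := by
          have : (0 : ℝ) ≤ 16 * ℓ + 1 := by positivity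
          rw [hβ₀_def]; linarith
        rw [div_le_iff₀ hc] at h3
        linarith
      calc ℓ / β k + T / (2 * β k) ≤ ℓ / β₀ + 1 / (2 * β₀) := add_le_add hℓβk hTβk
        _ = (ℓ + 1 / 2) / β₀ := by field_simp
        _ ≤ c / 4 := h2
    -- (Dᵀ): `s - ℓ/β_k ≤ e`
    have hsℓ : Real.log ((n : ℝ) + 1) / (2 * d * β k) = ℓ / β k := by
      rw [hℓ_def, div_div]
    rw [hsℓ] at hDk
    have hℓβ0 : 0 ≤ ℓ / β k := by positivity
    obtain ⟨sβ, hsβ_def⟩ : ∃ sβ : ℝ, sβ = s - ℓ / β k := ⟨_, rfl⟩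
    have hsβe : sβ ≤ e := by rw [hsβ_def, hs_def]; exact hDk
    have hsβ16 : 1 / 16 ≤ sβ := by rw [hsβ_def]; linarith
    have hsβ0 : 0 ≤ sβ := by linarith
    have hsβs : sβ ≤ s := by rw [hsβ_def]; linarith
    -- the monotone step on `t ↦ t - ½ R √t`
    have hR4 : R ≤ 4 * Real.sqrt sβ := by
      have h14 : (1 / 4 : ℝ) ≤ Real.sqrt sβ := by
        rw [Real.le_sqrt (by norm_num) hsβ0]; linarith
      linarith
    have hmono := kls_monotone_step hsβ0 hsβe hR4
    -- `½ R √sβ ≤ ½ √s ρ'`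
    have hRs : 1 / 2 * Real.sqrt sβ * R ≤ 1 / 2 * Real.sqrt s * ρ' :=
      mul_le_mul (mul_le_mul_of_nonneg_left (Real.sqrt_le_sqrt hsβs) (by norm_num)) hk hR0
        (by positivity)
    -- the thermal term
    have hTβ : 1 / (2 * β k) * T = T / (2 * β k) := one_div_mul_eq_div _ _
    -- assemble (all linear from here)
    have key : sβ - 1 / 2 * Real.sqrt sβ * R - 1 / (2 * β k) * T ≤ g := by
      linarith [h7, hmono]
    rw [hag]
    linarith [key, hRs, hTβ, hτβ, hsβ_def, hc_def]
  exact (half_pos hc).trans_le (le_liminf_of_le (isCoboundedUnder_ge_of_le atTop hbd) hev')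

/-- **WITNESS: Gibbs-state long-range order along a temperature schedule, in every `d ≥ 2` —
including two dimensions.** For the ferromagnetic quantum XY model of any spin `S = n/2 ≥ ½` on
the even tori `(ℤ/2kℤ)^d`, `d ≥ 2`, there is `β₀ > 0` such that along EVERY schedule
`L ↦ β_L > 0` with `β_L ≥ β₀ (1 + T_L)` the Gibbs states have long-range order:
`liminf_k (2k)^{-2d} Σ_{x,y} Re⟨S¹_xS¹_y + S²_xS²_y⟩_{β_{2k}} > 0`. In `d ≥ 3`, `T_L` is bounded
and this is the Dyson–Lieb–Simon / Kennedy–Lieb–Shastry theorem `kennedy_lieb_shastry_xy_thermal_holds`;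
in `d = 2`, `T_L ≤ (1 + log L)²` (`torusGreen_zero_two_le`; classically `T_L ∼ π⁻¹ log L`), so a
POLYLOGARITHMIC schedule suffices (`xy_gibbs_evenTorusLRO_two_polylog`) — although at every
FIXED `β < ∞` the two-dimensional model has no long-range order, its transverse correlations
obeying the very McBryan–Spencer / Koma–Tasaki power-law bound of this barrier ("By using Ito's
idea, one can prove the bound (4) ... for a large class of quantum spin systems with short range
interaction which is invariant under the global rotation about the `z`-axis"
[cite: KomaTasakiPRL1992, footnote [11]]). Proof: the thermal infrared bound (Aᵀ), Kubo (Bᵀ),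
sum rule (Cᵀ), energy bound (Dᵀ) and `1 ↔ 2` symmetry (Sᵀ) of the tree at `β = β_{2k}`,
[KLS1988PRL] eq. (7) at positive temperature (`kls_thermal_ineq7`, any `d ≥ 1`), and
`kls_thermal_margin_schedule`. [cite: KLS1988PRL, Theorem, eqs. (3)–(8)]
[cite: DysonLiebSimon1978, Thms. 4.2, 5.1 (as cited in KLS1988PRL, ref. 1)] -/
theorem xy_gibbs_evenTorusLRO_of_schedule (hd : 2 ≤ d) {n : ℕ} (hn : 1 ≤ n) :
    ∃ β₀ : ℝ, 0 < β₀ ∧ ∀ β : ℕ → ℝ, (∀ L, 0 < β L) →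
      (∀ (L : ℕ) [NeZero L], β₀ * (1 + torusGreen (0 : TorusSite d L)) ≤ β L) →
        HasEvenTorusLRO (fun L x y => xyCorrTorus (d := d) (β L) L n x y) := by
  obtain ⟨β₀, hβ₀, hmar⟩ := kls_thermal_margin_schedule (d := d) hd hn
  refine ⟨β₀, hβ₀, fun β hβpos hsched => ?_⟩
  have hd1 : 1 ≤ d := by omega
  have hd0 : (0 : ℝ) < d := by exact_mod_cast (show 0 < d by omega)
  rw [hasEvenTorusLRO_iff]
  refine hmar (fun k => β (2 * k)) _ (fun k => ?_) ?_
  · -- boundedness of the LRO sequence, from (Tᵀ)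
    refine div_le_of_le_mul₀ (by positivity) (by positivity) ?_
    have hb : ∀ x y : Site d,
        torusPullback (fun L x y => xyCorrTorus (d := d) (β L) L n x y) (2 * k) x y ≤
          2 * ((n : ℝ) / 2) ^ 2 := by
      intro x y
      rw [torusPullback_apply]
      rcases Nat.eq_zero_or_pos k with rfl | hk
      · have h0 : xyCorrTorus (d := d) (β (2 * 0)) (2 * 0) n (Torus.proj (2 * 0) x)
            (Torus.proj (2 * 0) y) = 0 := by
          simp [xyCorrTorus]
        rw [h0]
        positivity
      · haveI : NeZero (2 * k) := ⟨by omega⟩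
        rw [xyCorrTorus_eq_add]
        have h0 := le_of_abs_le (abs_re_gibbsState_xy_corr_le (β (2 * k)) (2 * k) n 0
          (Torus.proj (2 * k) x) (Torus.proj (2 * k) y))
        have h1 := le_of_abs_le (abs_re_gibbsState_xy_corr_le (β (2 * k)) (2 * k) n 1
          (Torus.proj (2 * k) x) (Torus.proj (2 * k) y))
        linarith
    calc ∑ x ∈ halfOpenBox d (2 * k), ∑ y ∈ halfOpenBox d (2 * k),
          torusPullback (fun L x y => xyCorrTorus (d := d) (β L) L n x y) (2 * k) x y
        ≤ ∑ x ∈ halfOpenBox d (2 * k), ∑ y ∈ halfOpenBox d (2 * k), 2 * ((n : ℝ) / 2) ^ 2 :=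
          sum_le_sum fun x _ => sum_le_sum fun y _ => hb x y
      _ = 2 * ((n : ℝ) / 2) ^ 2 * ((halfOpenBox d (2 * k)).card : ℝ) ^ 2 := by
          simp only [sum_const, nsmul_eq_mul]
          ring
  · -- eventually: the physics at side `L = 2k ≥ 4`, at inverse temperature `β_{2k}`
    filter_upwards [eventually_ge_atTop 2] with k hk2
    intro inst
    refine ⟨hsched (2 * k), ?_⟩
    have hL4 : 4 ≤ 2 * k := by omega
    have hL3 : 3 ≤ 2 * k := by omega
    have hLe : Even (2 * k) := even_two_mul k
    have hdpos : 0 < d := by omega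
    have hβk : 0 < β (2 * k) := hβpos (2 * k)
    have hLpos : (0 : ℝ) < ((2 * k : ℕ) : ℝ) ^ d :=
      pow_pos (by exact_mod_cast (show 0 < 2 * k by omega)) d
    have hNpos : (0 : ℝ) < (d : ℝ) * ((2 * k : ℕ) : ℝ) ^ d := mul_pos hd0 hLpos
    -- the correlation kernel `G^α(x,y) = Re⟨S^α_xS^α_y⟩_β`, abstracted
    obtain ⟨G, hG⟩ : ∃ G : Fin 3 → TorusSite d (2 * k) → TorusSite d (2 * k) → ℝ,
        ∀ α x y, (gibbsState (β (2 * k)) (xyTorus d (2 * k) n)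
          (siteSpin n x α * siteSpin n y α)).re = G α x y := ⟨fun α x y => _, fun _ _ _ => rfl⟩
    -- the inputs (Aᵀ), (Bᵀ), (Cᵀ), (Dᵀ), (Sᵀ)
    have hA := fun q hq => xy_infraredBound_thermal (d := d) (2 * k) hLe hL4 hdpos n hβk q hq
    have hB := xy_kubo_thermal (d := d) (2 * k) hLe hL4 n hβk
    have hC := sum_xy_structureFactor_mul_torusCosSum (d := d) (β (2 * k)) (2 * k) n 0
    have hD := xy_pairCorr_lower_thermal hd1 (2 * k) hL3 n hβk
    have hS : ∀ x y, G 1 x y = G 0 x y := fun x y => by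
      rw [← hG, ← hG, gibbsState_xy_corr_one_eq_zero]
    simp only [hG] at hA hB hC hD
    -- names for the pair sums and the structure factor
    set P0 : ℝ := ∑ x : TorusSite d (2 * k), ∑ i : Fin d, G 0 x (x + Pi.single i 1) with hP0
    set P2 : ℝ := ∑ x : TorusSite d (2 * k), ∑ i : Fin d, G 2 x (x + Pi.single i 1) with hP2
    set g : TorusSite d (2 * k) → ℝ := fun q =>
      (∑ x : TorusSite d (2 * k), ∑ y : TorusSite d (2 * k),
        Real.cos (torusPhase (2 * k) q (x - y)) * G 0 x y) / ((2 * k : ℕ) : ℝ) ^ d with hg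
    -- eq. (7) at positive temperature `β_{2k}`
    have h7 := kls_thermal_ineq7 hd1 (2 * k) hβk g
      (e₁ := P0 / ((d : ℝ) * ((2 * k : ℕ) : ℝ) ^ d)) (e₃ := P2 / ((d : ℝ) * ((2 * k : ℕ) : ℝ) ^ d))
      (fun q hq => hA q hq) ?_ ?_
    rotate_left
    · -- (Bᵀ) in averaged form
      rw [abs_div, abs_of_pos hNpos]
      exact div_le_div_of_nonneg_right hB hNpos.le
    · -- (Cᵀ) in averaged form
      have h1 : ∑ q : TorusSite d (2 * k), g q * (torusCosSum (2 * k) q / d) =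
          (∑ q : TorusSite d (2 * k), (∑ x : TorusSite d (2 * k), ∑ y : TorusSite d (2 * k),
            Real.cos (torusPhase (2 * k) q (x - y)) * G 0 x y) * torusCosSum (2 * k) q) /
            (((2 * k : ℕ) : ℝ) ^ d * d) := by
        rw [sum_div]
        refine sum_congr rfl fun q _ => ?_
        rw [hg, div_mul_div_comm]
      rw [h1, hC]
      field_simp
    -- the LRO term is `2 |Λ|⁻¹ ĝ₀`
    refine ⟨P0 / ((d : ℝ) * ((2 * k : ℕ) : ℝ) ^ d), g 0 / ((2 * k : ℕ) : ℝ) ^ d, ?_, h7, hD⟩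
    rw [XYOrderProofs.sum_halfOpenBox_torusPullback, card_halfOpenBox, hg]
    simp only [xyCorrTorus_eq_add, hG, hS, ← two_mul, ← mul_sum, torusPhase_zero_left,
      Real.cos_zero, one_mul]
    push_cast
    field_simp


/-- **Two dimensions, explicit schedules.** For the quantum XY model of any spin on `(ℤ/2kℤ)²`
there is `β₀ > 0` such that every schedule with `β_L ≥ β₀ (1 + (1 + log L)²)` carries Gibbs-state
long-range order along the even tori. (`xy_gibbs_evenTorusLRO_of_schedule` at `d = 2` with
`torusGreen_zero_two_le`.) [cite: KLS1988PRL, Theorem] -/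
theorem xy_gibbs_evenTorusLRO_two_of_logSq_le {n : ℕ} (hn : 1 ≤ n) :
    ∃ β₀ : ℝ, 0 < β₀ ∧ ∀ β : ℕ → ℝ,
      (∀ L : ℕ, β₀ * (1 + (1 + Real.log L) ^ 2) ≤ β L) →
        HasEvenTorusLRO (fun L x y => xyCorrTorus (d := 2) (β L) L n x y) := by
  obtain ⟨β₀, hβ₀, h⟩ := xy_gibbs_evenTorusLRO_of_schedule (d := 2) le_rfl hn
  refine ⟨β₀, hβ₀, fun β hβ => h β (fun L => ?_) (fun L _ => ?_)⟩
  · have h1 := hβ L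
    have h2 : 0 < β₀ * (1 + (1 + Real.log L) ^ 2) := by positivity
    linarith
  · calc β₀ * (1 + torusGreen (0 : TorusSite 2 L)) ≤ β₀ * (1 + (1 + Real.log L) ^ 2) := by
          gcongr
          exact torusGreen_zero_two_le L
      _ ≤ β L := hβ L

/-- **Two dimensions, one line**: Gibbs-state long-range order of the two-dimensional quantum XY
model (any spin) along the polylogarithmic temperature schedule `β_L = β₀ (1 + (1 + log L)²)`,
`T_L = β_L⁻¹ → 0` like `(log L)⁻²` — a positive-temperature, `U(1)`-breaking, two-point
long-range order in `d = 2`, beyond the edge of the Hohenberg–Mermin–Wagner / Koma–Tasaki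
obstruction (which is void once `β_L ≳ log L`). [cite: KLS1988PRL, Theorem] -/
theorem xy_gibbs_evenTorusLRO_two_polylog {n : ℕ} (hn : 1 ≤ n) :
    ∃ β₀ : ℝ, 0 < β₀ ∧
      HasEvenTorusLRO (fun L x y =>
        xyCorrTorus (d := 2) (β₀ * (1 + (1 + Real.log L) ^ 2)) L n x y) := by
  obtain ⟨β₀, hβ₀, h⟩ := xy_gibbs_evenTorusLRO_two_of_logSq_le hn
  exact ⟨β₀, hβ₀, h _ fun L => le_rfl⟩

end Witness

end Literature.Barriers.HubbardSuperconductivity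

/-! ### Narrowing (barrier audit 2026-08-15): the exact reach in temperature — schedules `β = β_L`, both halves (pairs and spins) — and what the tokens cover

The catalogued statement fixes `β` BEFORE the side `L` varies. The audit below makes the
temperature dependence explicit with the constants of `HubbardHubbardModelKomaTasakiProofs`
(`|⟨A⟩_{β,L}| ≤ e · (dist(x, y) + 1)^{-q(β|t|)}`, `q(b) = 1/(128 b + 1)`, for BOTH the on-site pair
`A = c†_{x↑}c†_{x↓}c_{y↓}c_{y↑}` and the transverse spin `A = S⁺_x S⁻_y`, from
`norm_thermalCorr_onSitePair_le` / `norm_thermalCorr_siteSpinPlus_le` and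
`le_rpow_of_forall_testFunction_two`) and proves the two-sided frontier of the mechanism:
(a) NO torus long-range order along ANY temperature schedule `β_L` with `β_L |t| = o(log L)`
(`not_hasTorusLRO_thermal_of_schedule`, through the summation lemma with an `L`-dependent
exponent `not_hasTorusLRO_of_abs_le_rpow_schedule`, cut-off radius `R_L = ⌊√L⌋`); (b) the
bound is VOID — implied by `|⟨A⟩| ≤ ‖A‖ ≤ 1` at every pair of sites of the torus — as soon as
`log(L + 1) ≤ 128 β|t| + 1` (`one_le_komaTasakiBound_of_log_le`). So the Hohenberg–Mermin–Wagner
/ Koma–Tasaki obstruction covers exactly the Gibbs states at `β_L|t| ≲ log L`; compare the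
sibling audit `HohenbergMerminWagnerPairingNarrow` (edge (b) for the pair FIELD, and the
literature on infrared bounds continued to `T = 0`), which this section complements with (a) and
with the magnetic half. -/

namespace Literature.Barriers.HubbardSuperconductivity

open Filter Finset Topology Matrix Literature.MathematicalPhysics.QuantumLattice
  Literature.Probability.LatticeModels

section Schedules

variable {d : ℕ}

/-- **Power-law decay with a side-dependent exponent still excludes torus long-range order, as
long as `f_L log L → ∞`** (`d ≥ 1`). If `|G_L(x, y)| ≤ C (dist(x, y) + 1)^{-f_L}` on `(ℤ/Lℤ)^d`
with `f_L ≥ 0` and `f_L · log L → ∞`, then `L^{-2d} Σ_{x,y} G_L(x, y) → 0`, hence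
`¬ HasTorusLRO G`: with the cut-off radius `R_L = ⌊√L⌋` the row-sum estimate
`Σ_y (dist + 1)^{-f_L} ≤ (2R_L + 1)^d + L^d (R_L + 1)^{-f_L}` (`sum_abs_le_of_abs_le_rpow`) gives
`|a_L| ≤ max(C,0) (3^d / R_L^d + e^{-f_L log L / 2})` (since `(2R_L + 1) R_L ≤ 3L` and
`(R_L + 1)² > L`). The fixed-exponent lemma `not_hasTorusLRO_of_abs_le_rpow` is the case
`f_L ≡ f > 0`. (Friedli–Velenik 2017, §3.7.2, Definition 3.27; Koma–Tasaki, remark after the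
Theorem.) [folklore] -/
theorem not_hasTorusLRO_of_abs_le_rpow_schedule (hd : d ≠ 0)
    {G : (L : ℕ) → TorusSite d L → TorusSite d L → ℝ} {C : ℝ} {f : ℕ → ℝ}
    (hf : ∀ L, 0 ≤ f L) (hfl : Tendsto (fun L : ℕ => f L * Real.log (L : ℝ)) atTop atTop)
    (hG : ∀ (L : ℕ) [NeZero L] (x y : TorusSite d L),
      |G L x y| ≤ C * ((torusDist x y : ℝ) + 1) ^ (-(f L))) :
    ¬ HasTorusLRO G := by
  classical
  set a : ℕ → ℝ := fun L =>
    (∑ x ∈ halfOpenBox d L, ∑ y ∈ halfOpenBox d L, torusPullback G L x y) /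
      (#(halfOpenBox d L) : ℝ) ^ 2 with ha
  set C' : ℝ := max C 0 with hC'
  have hC'0 : 0 ≤ C' := le_max_right _ _
  -- the basic estimate, for every cut-off radius `R` and every side `L ≥ 1`
  have hest : ∀ (R L : ℕ), L ≠ 0 →
      |a L| ≤ C' * (2 * R + 1 : ℝ) ^ d / (L : ℝ) ^ d + C' * ((R : ℝ) + 1) ^ (-(f L)) := by
    intro R L hL
    haveI : NeZero L := ⟨hL⟩
    have hLpos : (0 : ℝ) < (L : ℝ) ^ d := by positivity
    set B : ℝ := (2 * R + 1 : ℝ) ^ d + (L : ℝ) ^ d * ((R : ℝ) + 1) ^ (-(f L)) with hB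
    have hrow : ∀ x ∈ halfOpenBox d L,
        |∑ y ∈ halfOpenBox d L, torusPullback G L x y| ≤ C' * B := by
      intro x _
      calc |∑ y ∈ halfOpenBox d L, torusPullback G L x y|
          ≤ ∑ y ∈ halfOpenBox d L, |torusPullback G L x y| := Finset.abs_sum_le_sum_abs _ _
        _ = ∑ y : TorusSite d L, |G L (Torus.proj L x) y| :=
            HubbardHubbardModelProofs.sum_halfOpenBox_torusPullback (fun L x y => |G L x y|) L x
        _ ≤ C' * B := sum_abs_le_of_abs_le_rpow (hf L) (fun x y => hG L x y) _ R
    have hS : |∑ x ∈ halfOpenBox d L, ∑ y ∈ halfOpenBox d L, torusPullback G L x y| ≤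
        (L : ℝ) ^ d * (C' * B) := by
      calc |∑ x ∈ halfOpenBox d L, ∑ y ∈ halfOpenBox d L, torusPullback G L x y|
          ≤ ∑ x ∈ halfOpenBox d L, |∑ y ∈ halfOpenBox d L, torusPullback G L x y| :=
            Finset.abs_sum_le_sum_abs _ _
        _ ≤ #(halfOpenBox d L) • (C' * B) := Finset.sum_le_card_nsmul _ _ _ hrow
        _ = (L : ℝ) ^ d * (C' * B) := by rw [nsmul_eq_mul, card_halfOpenBox]; push_cast; ring
    have hcard : (#(halfOpenBox d L) : ℝ) = (L : ℝ) ^ d := by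
      rw [card_halfOpenBox]; push_cast; ring
    rw [ha]
    dsimp only
    rw [hcard, abs_div, abs_of_nonneg (by positivity : (0 : ℝ) ≤ ((L : ℝ) ^ d) ^ 2),
      div_le_iff₀ (by positivity)]
    calc |∑ x ∈ halfOpenBox d L, ∑ y ∈ halfOpenBox d L, torusPullback G L x y|
        ≤ (L : ℝ) ^ d * (C' * B) := hS
      _ = (C' * (2 * R + 1 : ℝ) ^ d / (L : ℝ) ^ d + C' * ((R : ℝ) + 1) ^ (-(f L))) *
            ((L : ℝ) ^ d) ^ 2 := by
          rw [hB]; field_simp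
  -- the cut-off radius `R_L = ⌊√L⌋`: the first term, `(2R_L + 1)^d / L^d ≤ 3^d / R_L^d`
  have hb1 : ∀ L : ℕ, L ≠ 0 →
      C' * (2 * (Nat.sqrt L : ℕ) + 1 : ℝ) ^ d / (L : ℝ) ^ d ≤
        C' * (3 : ℝ) ^ d / ((Nat.sqrt L : ℕ) : ℝ) ^ d := by
    intro L hL
    set s : ℕ := Nat.sqrt L with hs
    have hs1 : 1 ≤ s := by
      rw [hs, Nat.le_sqrt]
      omega
    have hsL : s * s ≤ L := Nat.sqrt_le L
    have hspos : (0 : ℝ) < (s : ℝ) := by exact_mod_cast hs1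
    have hLpos : (0 : ℝ) < (L : ℝ) := by exact_mod_cast Nat.pos_of_ne_zero hL
    rw [mul_div_assoc, mul_div_assoc]
    refine mul_le_mul_of_nonneg_left ?_ hC'0
    rw [div_le_div_iff₀ (by positivity) (by positivity), ← mul_pow, ← mul_pow]
    refine pow_le_pow_left₀ (by positivity) ?_ d
    have h1 : (2 * s + 1) * s ≤ 3 * L := by nlinarith
    exact_mod_cast h1
  -- the second term, `(R_L + 1)^{-f_L} ≤ e^{-f_L log L / 2}` since `(R_L + 1)² > L`
  have hb2 : ∀ L : ℕ, L ≠ 0 →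
      C' * (((Nat.sqrt L : ℕ) : ℝ) + 1) ^ (-(f L)) ≤
        C' * Real.exp (-(f L * Real.log (L : ℝ)) / 2) := by
    intro L hL
    refine mul_le_mul_of_nonneg_left ?_ hC'0
    set s : ℕ := Nat.sqrt L with hs
    have hs0 : (0 : ℝ) < (s : ℝ) + 1 := by positivity
    have hLpos : (0 : ℝ) < (L : ℝ) := by exact_mod_cast Nat.pos_of_ne_zero hL
    have hlt : L < (s + 1) ^ 2 := Nat.lt_succ_sqrt' L
    have hlog : Real.log (L : ℝ) ≤ Real.log (((s : ℝ) + 1) ^ 2) :=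
      Real.log_le_log hLpos (by exact_mod_cast hlt.le)
    rw [Real.log_pow] at hlog
    push_cast at hlog
    rw [Real.rpow_def_of_pos hs0]
    refine Real.exp_le_exp.mpr ?_
    have hf0 := hf L
    nlinarith
  -- the squeeze
  have hbound : ∀ᶠ L : ℕ in atTop, ‖a L‖ ≤
      C' * (3 : ℝ) ^ d / ((Nat.sqrt L : ℕ) : ℝ) ^ d +
        C' * Real.exp (-(f L * Real.log (L : ℝ)) / 2) := by
    filter_upwards [eventually_ne_atTop 0] with L hL
    rw [Real.norm_eq_abs]
    exact (hest (Nat.sqrt L) L hL).trans (add_le_add (hb1 L hL) (hb2 L hL))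
  have hsqrt : Tendsto Nat.sqrt atTop atTop := by
    refine tendsto_atTop_atTop.2 fun b => ⟨b ^ 2, fun n hn => ?_⟩
    calc b = Nat.sqrt (b ^ 2) := (Nat.sqrt_eq' b).symm
      _ ≤ Nat.sqrt n := Nat.sqrt_le_sqrt hn
  have hlim : Tendsto (fun L : ℕ =>
      C' * (3 : ℝ) ^ d / ((Nat.sqrt L : ℕ) : ℝ) ^ d +
        C' * Real.exp (-(f L * Real.log (L : ℝ)) / 2)) atTop (𝓝 0) := by
    have h1 : Tendsto (fun L : ℕ => C' * (3 : ℝ) ^ d / ((Nat.sqrt L : ℕ) : ℝ) ^ d)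
        atTop (𝓝 0) :=
      tendsto_const_nhds.div_atTop
        ((tendsto_pow_atTop hd).comp (tendsto_natCast_atTop_atTop.comp hsqrt))
    have h3 : Tendsto (fun L : ℕ => -(f L * Real.log (L : ℝ)) / 2) atTop atBot :=
      (tendsto_neg_atTop_atBot.comp hfl).atBot_div_const (by norm_num)
    have h2 : Tendsto (fun L : ℕ => C' * Real.exp (-(f L * Real.log (L : ℝ)) / 2))
        atTop (𝓝 0) := by
      simpa using (Real.tendsto_exp_atBot.comp h3).const_mul C'
    simpa using h1.add h2
  have hT : Tendsto a atTop (𝓝 0) := squeeze_zero_norm' hbound hlim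
  intro hLRO
  change 0 < liminf a atTop at hLRO
  rw [hT.liminf_eq] at hLRO
  exact lt_irrefl 0 hLRO

/-- **The Koma–Tasaki mechanism along temperature schedules** (the positive side of the
frontier). For the Hubbard model on the tori `(ℤ/Lℤ)²`, all `t, U, μ` and EVERY temperature
schedule `L ↦ β_L ≥ 0` with `β_L |t| = o(log L)` — formally
`log L / (1 + β_L|t|) → ∞` — neither the thermal on-site pair two-point function
`re⟨c†_{x↑}c†_{x↓}c_{y↓}c_{y↑}⟩_{β_L, L}` nor the transverse spin two-point function
`re⟨S⁺_x S⁻_y⟩_{β_L, L}` has torus long-range order along the schedule. Constant schedules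
`β_L ≡ β` are the catalogued `koma_tasaki_noLRO`; `β_L = (log L)^{1-ε}`, `β_L = log log L`, …
are new. Proof: the explicit finite-volume bounds
`|⟨A⟩_{β,L}| ≤ e (dist(x, y) + 1)^{-1/(128β|t| + 1)}` for both observables
(`norm_thermalCorr_onSitePair_le`, `norm_thermalCorr_siteSpinPlus_le`,
`le_rpow_of_forall_testFunction_two`, i.e. eqs. (5)–(13) of the source with the
McBryan–Spencer profile), and `not_hasTorusLRO_of_abs_le_rpow_schedule` with
`f_L = 1/(128 β_L|t| + 1)`, `f_L log L ≥ log L / (128 (1 + β_L|t|)) → ∞`.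
[cite: KomaTasakiPRL1992, Theorem eqs. (2), (4) and p. 3 ("the power indices ... are proportional to β⁻¹ at low temperatures")] -/
theorem not_hasTorusLRO_thermal_of_schedule (t U μ : ℝ) {β : ℕ → ℝ} (hβ0 : ∀ L, 0 ≤ β L)
    (hβ : Tendsto (fun L : ℕ => Real.log (L : ℝ) / (1 + β L * |t|)) atTop atTop) :
    ¬ HasTorusLRO (fun L => thermalPairCorr (d := 2) (β L) t U μ L) ∧
      ¬ HasTorusLRO (fun L => thermalSpinCorr (d := 2) (β L) t U μ L) := by
  set f : ℕ → ℝ := fun L => 1 / (128 * (β L * |t|) + 1) with hfdef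
  have hb : ∀ L, 0 ≤ β L * |t| := fun L => mul_nonneg (hβ0 L) (abs_nonneg t)
  have hf : ∀ L, 0 ≤ f L := fun L => by
    have := hb L
    simp only [hfdef]
    positivity
  have hfl : Tendsto (fun L : ℕ => f L * Real.log (L : ℝ)) atTop atTop := by
    have hcmp : ∀ᶠ L : ℕ in atTop,
        (1 / 128 : ℝ) * (Real.log (L : ℝ) / (1 + β L * |t|)) ≤ f L * Real.log (L : ℝ) := by
      filter_upwards [eventually_ge_atTop 1] with L hL
      have hlog : 0 ≤ Real.log (L : ℝ) := Real.log_nonneg (by exact_mod_cast hL)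
      have hbL := hb L
      simp only [hfdef]
      calc (1 / 128 : ℝ) * (Real.log (L : ℝ) / (1 + β L * |t|))
          = Real.log (L : ℝ) / ((1 + β L * |t|) * 128) := by rw [one_div_mul_eq_div, div_div]
        _ ≤ Real.log (L : ℝ) / (128 * (β L * |t|) + 1) :=
            div_le_div_of_nonneg_left hlog (by positivity) (by linarith)
        _ = 1 / (128 * (β L * |t|) + 1) * Real.log (L : ℝ) := by rw [one_div_mul_eq_div]
    exact tendsto_atTop_mono' atTop hcmp (hβ.const_mul_atTop (by norm_num))
  have hpair : ∀ (L : ℕ) [NeZero L] (x y : TorusSite 2 L),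
      |(fun L => thermalPairCorr (d := 2) (β L) t U μ L) L x y| ≤
        Real.exp 1 * ((torusDist x y : ℝ) + 1) ^ (-(f L)) := by
    intro L _ x y
    cases L with
    | zero => exact absurd rfl (NeZero.ne 0)
    | succ n =>
      simp only [thermalPairCorr_succ, hfdef]
      refine (Complex.abs_re_le_norm _).trans ?_
      exact le_rpow_of_forall_testFunction_two (hb _) x y
        (fun ψ => norm_thermalCorr_onSitePair_le t U μ (β (n + 1)) (hβ0 _) ψ x y)
  have hspin : ∀ (L : ℕ) [NeZero L] (x y : TorusSite 2 L),
      |(fun L => thermalSpinCorr (d := 2) (β L) t U μ L) L x y| ≤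
        Real.exp 1 * ((torusDist x y : ℝ) + 1) ^ (-(f L)) := by
    intro L _ x y
    cases L with
    | zero => exact absurd rfl (NeZero.ne 0)
    | succ n =>
      simp only [thermalSpinCorr_succ, hfdef]
      refine (Complex.abs_re_le_norm _).trans ?_
      exact le_rpow_of_forall_testFunction_two (hb _) x y
        (fun ψ => norm_thermalCorr_siteSpinPlus_le t U μ (β (n + 1)) (hβ0 _) ψ x y)
  exact ⟨not_hasTorusLRO_of_abs_le_rpow_schedule two_ne_zero hf hfl hpair,
    not_hasTorusLRO_of_abs_le_rpow_schedule two_ne_zero hf hfl hspin⟩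

variable {L : ℕ}

/-- **The a priori bound for the pair correlation**: `|⟨c†_{x↑}c†_{x↓}c_{y↓}c_{y↑}⟩_{β,L}| ≤ 1`
for all `β ≥ 0` (the test-function bound `norm_thermalCorr_onSitePair_le` at `ψ = 0`, i.e.
`|⟨A⟩| ≤ ‖A‖ ≤ 1`) — what boundedness of states alone gives. [folklore] -/
theorem norm_thermalCorr_onSitePair_le_one [NeZero L] (t U μ : ℝ) {β : ℝ} (hβ : 0 ≤ β)
    (x y : TorusSite 2 L) :
    ‖(hubbardTorusWith 2 L t U μ).thermalCorr β (onSitePair x)ᴴ (onSitePair y)‖ ≤ 1 := by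
  have h := norm_thermalCorr_onSitePair_le t U μ β hβ (fun _ => (0 : ℝ)) x y
  simpa using h

/-- **The a priori bound for the transverse spin correlation**: `|⟨S⁺_x S⁻_y⟩_{β,L}| ≤ 1` for all
`β ≥ 0` (`norm_thermalCorr_siteSpinPlus_le` at `ψ = 0`). [folklore] -/
theorem norm_thermalCorr_siteSpinPlus_le_one [NeZero L] (t U μ : ℝ) {β : ℝ} (hβ : 0 ≤ β)
    (x y : TorusSite 2 L) :
    ‖(hubbardTorusWith 2 L t U μ).thermalCorr β (siteSpinPlus x) (siteSpinPlus y)ᴴ‖ ≤ 1 := by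
  have h := norm_thermalCorr_siteSpinPlus_le t U μ β hβ (fun _ => (0 : ℝ)) x y
  simpa using h

/-- **The edge of the barrier, quantitatively** (this entry's constants; the negative side of
the frontier). On the torus of side `L ≥ 1`, as soon as `log(L + 1) ≤ 128 b + 1` (`b = β|t|`)
the explicit Koma–Tasaki bound `e · (dist(x, y) + 1)^{-1/(128 b + 1)}` is `≥ 1` at EVERY pair
of sites (`dist ≤ L`, so the exponent times `log(dist + 1)` is `≤ 1`), hence weaker than the a
priori bounds `norm_thermalCorr_onSitePair_le_one` / `norm_thermalCorr_siteSpinPlus_le_one`: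
along any schedule `β_L ≥ log(L + 1)/(128|t|)` the Theorem carries no information. With the
printed optimal constants (`α f(β) ≈ (2πβt)⁻¹` [cite: KomaTasakiPRL1992, footnote [9]]) the
threshold reads `2πβt ≳ log L`. [cite: KomaTasakiPRL1992, p. 3 ("proportional to β⁻¹ at low temperatures")] -/
theorem one_le_komaTasakiBound_of_log_le [NeZero L] {b : ℝ} (hb : 0 ≤ b)
    (x y : TorusSite 2 L) (hL : Real.log ((L : ℝ) + 1) ≤ 128 * b + 1) :
    1 ≤ Real.exp 1 * ((torusDist x y : ℝ) + 1) ^ (-(1 / (128 * b + 1))) := by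
  have hDL : torusDist x y ≤ L := by
    unfold torusDist torusNorm
    exact Finset.sup_le fun i _ => (min_le_right _ _).trans (Nat.sub_le _ _)
  have hRL : ((torusDist x y : ℕ) : ℝ) ≤ (L : ℝ) := by exact_mod_cast hDL
  have hRpos : (0 : ℝ) < ((torusDist x y : ℕ) : ℝ) + 1 := by positivity
  have hq0 : 0 < 1 / (128 * b + 1) := by positivity
  have hlogR : Real.log (((torusDist x y : ℕ) : ℝ) + 1) ≤ Real.log ((L : ℝ) + 1) :=
    Real.log_le_log hRpos (by linarith)
  have hlogR0 : 0 ≤ Real.log (((torusDist x y : ℕ) : ℝ) + 1) := Real.log_nonneg (by linarith)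
  have key : Real.log (((torusDist x y : ℕ) : ℝ) + 1) * (1 / (128 * b + 1)) ≤ 1 := by
    calc Real.log (((torusDist x y : ℕ) : ℝ) + 1) * (1 / (128 * b + 1))
        ≤ (128 * b + 1) * (1 / (128 * b + 1)) :=
          mul_le_mul_of_nonneg_right (hlogR.trans hL) hq0.le
      _ = 1 := by rw [mul_one_div, div_self (by positivity)]
  rw [Real.rpow_def_of_pos hRpos, ← Real.exp_add]
  exact Real.one_le_exp (by nlinarith)

end Schedules

/-- **NARROWED BARRIER `PositiveTemperatureNoPairLRONarrow` (barrier audit of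
`PositiveTemperatureNoPairLRO`, 2026-08-15).** Three conjuncts, all proved
(`positiveTemperatureNoPairLRONarrow_holds`). (1) THE OBSTRUCTION, unchanged: the catalogued
`PositiveTemperatureNoPairLRO` (`koma_tasaki_2d ∧ koma_tasaki_noLRO`) — mind the ORDER OF
QUANTIFIERS: `β` is fixed before the side `L` varies. (2) THE REACH, new: for all `t, U, μ` and
EVERY schedule `β : ℕ → ℝ≥0` with `log L / (1 + β_L|t|) → ∞` (`β_L|t| = o(log L)`: constant `β`,
`β_L = (log L)^{1-ε}`, …), the thermal on-site pair AND transverse spin two-point functions of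
the Gibbs states `⟨·⟩_{β_L, L}` on `(ℤ/Lℤ)²` have no torus long-range order along the schedule
(`not_hasTorusLRO_thermal_of_schedule`). (3) THE EDGE, formal: for `b = β|t| ≥ 0`, every side
`L ≥ 1` with `log(L + 1) ≤ 128 b + 1` and all sites `x, y`: `|⟨c†c†cc⟩_{β,L}| ≤ 1`,
`|⟨S⁺_x S⁻_y⟩_{β,L}| ≤ 1` and `1 ≤ e (dist(x, y) + 1)^{-1/(128 b + 1)}` — there the explicit
Koma–Tasaki bound of the tree (`le_rpow_of_forall_testFunction_two`) is implied by boundedness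
of states and says nothing. Together: the mechanism constrains Gibbs states exactly while
`β_L|t| ≲ log L` (tree constants: blocked for `128(1 + β_L|t|) = o(log L)`, void for
`128 β_L|t| + 1 ≥ log(L + 1)`; printed optimal constants `αf(β) ≈ (2πβt)⁻¹`
[cite: KomaTasakiPRL1992, Theorem and footnote [9]]).

technique_class: fixed-or-sublogarithmic-temperature-Gibbs-state-two-point-LRO U(1)-charged-or-spin-charged-local-observable L-uniform-beta T_c>0-for-pair-or-transverse-spin-LRO-in-pure-2D-Hubbard thermal-two-point-Cesaro-mean-at-beta_L=o(logL) finite-T-numerics-extrapolated-in-L-at-fixed-T continuation-from-an-ordered-phase-at-fixed-T>0 (explicitly and only: `HasTorusLRO` — or any functional dominated by `L⁻⁴ Σ_{x,y} |⟨A_x† A_y⟩_{β_L,L}|` — of the two-point function of a local observable `A` carrying `U(1)` charge (pairs `c c`, bond pairs, `P_x = c_{x,σ₁} ⋯ c_{x+δ_n,σ_n}` [cite: KomaTasakiPRL1992, footnote [10]]) or transverse spin (`S^±` under `z`-fields), in Gibbs states along a schedule with `β_L|t| = o(log L)`); the catalogued entry's tokens "positive-temperature-methods", "Gibbs-state-LRO",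 "thermal-order-parameter", "finite-T-numerics-read-as-LRO" are to be READ THIS WAY. NOT covered although matched by those tokens: (α) Gibbs states along schedules `β_L ≥ log(L + 1)/(128|t|)` — ground-state proxies `β_L ≍ L^z`, projector/annealing estimates, "`β = L`" numerics — conjunct (3); (β) positive-temperature reflection-positivity / Gaussian-domination / infrared bounds, either continued to `β → ∞` at FIXED `L` and then `L → ∞` (the Neves–Perez / Kennedy–Lieb–Shastry mechanism; tree: `kennedy_lieb_shastry_xy_ground_holds`, ground-state LRO of the two-dimensional quantum XY model for every spin), or run ALONG A SCHEDULE `β_L ≳ T_L ≍ log L` (this file: `xy_gibbs_evenTorusLRO_two_polylog`, Gibbs-state LRO of the same two-dimensional model along `β_L = β₀(1 + (1 + log L)²)`) — a `U(1)`-symmetric model obeying this very barrier at every fixed `T > 0` [cite: KomaTasakiPRL1992, footnote [11]]; (γ) fixed-`β` certificates other than two-point long-range order — `β`-uniform algebraic LOWER bounds with exponent `η(β) → 0` (the Kosterlitz–Thouless shape the Theorem itself permits), pair susceptibilities, and above all the HELICITY MODULUS / superfluid stiffness `ρ_s(T) = D_s/4πe² = ¼[Λ^L - Λ^T]` (a current–current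 response, not a two-point order functional), which is `> 0` for `0 < T < T_BKT` in a two-dimensional superconductor and is how "`T_c`" of the two-dimensional (attractive) Hubbard model is defined and measured, via the universal jump `T_c = (π/2) ρ_s⁻` [cite: PaivaEtAl2004, abstract, p. 2 and eqs. for ρ_s and T_c (pp. 3–4)] [cite: NelsonKosterlitz1977, title claim (universal jump of the superfluid density)]; (δ) CHARGE-NEUTRAL composites of pairs — Ising-like vestigial orders (pair chirality `i(Δ_a†Δ_b - h.c.)`, pair nematicity, the period of a pair-density wave) break only discrete symmetries and may have TRUE long-range order at `T > 0` in `d = 2` while the primary pairing order has none: "T_0 > T_BKT signals a true Ising-like phase transition to the vestigial state that breaks time-reversal symmetry, but does not display quasi-long-range superconducting order"; "In a two-dimensional system, where long-range order of the primary order parameters is prohibited by the Hohenberg-Mermin-Wagner theorem, a vestigial phase having only the Ising-like order parameters … will take place" [cite: FernandesOrthSchmalian2019, arXiv pp. 8 and 10]; such Gibbs-state LRO of a neutral local observable is untouched by the gauge argument (the observable commutes with `exp[-Σ φ_u n_u]`, eigenvalue `1`).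
blocks: (a) exactly what the catalogued entry blocks — superconducting (on-site pair; bond / `d_{x²-y²}` pair field by the sibling entry `HohenbergMerminWagnerPairing`) or transverse magnetic LONG-RANGE ORDER of the two-dimensional Hubbard Gibbs state at ONE `β < ∞` held fixed as `L → ∞`, for every `t, U, μ` [cite: KomaTasakiPRL1992, Theorem eqs. (2), (4) and p. 3]; (b) NEW — the same along every temperature schedule with `β_L|t| = o(log L)` (conjunct (2)): "slowly cooled" Gibbs states do not escape; (c) hence routes to the `T = 0` summit whose certificate is two-point LRO of such Gibbs states, and finite-`T` numerics extrapolated in `L` at fixed `T` read as LRO. Nothing else: (α)–(δ) of `technique_class` are outside the class — in particular a Berezinskii–Kosterlitz–Thouless superconducting phase at `0 < T < T_BKT` (stiffness `> 0`, algebraic order) is fully compatible with the Theorem ("a finite temperature Kosterlitz-Thouless (KT) transition into a SS phase takes place; this phase has only algebraically decaying correlations for `0 < T ≤ T_c`" [cite: PaivaEtAl2004, p. 2]), so "`T_c > 0` for the 2D Hubbard model" in the BKT sense is NOT blocked — only `T_c > 0` for LONG-RANGE ORDER is.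
because: conjunct (1) is `PositiveTemperatureNoPairLRO_holds`; conjunct (2): the gauge transformation `exp[-Σ_u φ_u n_{u}]` (charge weights) resp. `exp[∓Σ_u ψ_u n_{u,σ}]` (spin weights) and the trace inequalities give, for every real test function, `|⟨A⟩_{β,L}| ≤ e^{-2(ψ_x - ψ_y)} exp[2β|t| Σ_{u∼u'}(cosh(ψ_u - ψ_{u'}) - 1)]` (`norm_thermalCorr_onSitePair_le`, `norm_thermalCorr_siteSpinPlus_le`) [cite: KomaTasakiPRL1992, eqs. (5)–(12)]; the McBryan–Spencer profile `ψ_x - ψ_y = q log(R + 1)` with energy `≤ 64 q²(log(R + 1) + 1)`, `q = 1/(128β|t| + 1)`, yields `|⟨A⟩_{β,L}| ≤ e (R + 1)^{-q}`, `R = dist(x, y)` (`le_rpow_of_forall_testFunction_two`) [cite: McBryanSpencer1977] [cite: KomaTasakiPRL1992, P1–P2 and eq. (13)]; the exponent is `q(β_L|t|) ≥ 1/(128(1 + β_L|t|))`, so `q_L log L → ∞` exactly when `β_L|t| = o(log L)`, and then the row sums `Σ_y (dist + 1)^{-q_L} ≤ (2√L + 1)² + L² (√L)^{-q_L} = o(L²)`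 kill `liminf L⁻⁴ Σ_{x,y}` (`not_hasTorusLRO_of_abs_le_rpow_schedule`); conjunct (3): `dist ≤ L` and `q log(L + 1) ≤ 1` give `e (dist + 1)^{-q} ≥ e · e⁻¹ = 1 ≥ ‖A‖ ≥ |⟨A⟩|` — every Hohenberg–Mermin–Wagner bound in `d = 2` trades the symmetry-breaking factor `e^{-2(ψ_x - ψ_y)}` against a Dirichlet energy `≍ β|t| q² log|x - y|`, so the decay rate is `∝ (β|t|)⁻¹` per unit of `log|x - y|` and nothing is gained while `log|x - y| ≲ β|t|` ("the power indices ... are proportional to `β⁻¹` at low temperatures. This means that the slowest possible decay in these models is of the Kosterlitz-Thouless type" [cite: KomaTasakiPRL1992, p. 3]).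
evasions_known: (i)–(iii) of `PositiveTemperatureNoPairLRO` and (vi)–(viii) of `HohenbergMerminWagnerPairingNarrow` (temperature schedules beyond the edge; thermal infrared bounds continued to `T = 0` at fixed volume [cite: KLS1988JSP, pp. 1019–1021 (as quoted in `HohenbergMerminWagnerPairingNarrow`)] [cite: KLS1988PRL, pp. 2582–2583 (as quoted there; tree: `kennedy_lieb_shastry_xy_ground_holds`)]; fixed-`β` certificates other than LRO [cite: FrohlichSpencerKT1981, title claim (power-law lower bounds in the classical two-dimensional rotator)]), and, sharpened here: (ix) the EXACT REACH — by conjunct (2) no schedule with `β_L|t| = o(log L)` evades, by conjunct (3) every schedule with `128β_L|t| + 1 ≥ log(L + 1)` does; in reflection-positive `U(1)` models the window is genuinely populated, and this is PROVED in this file (section Witness): by the Dyson–Lieb–Simon thermal infrared bound `ĝ_L(p) ≤ 1/(2βE_p) + ½[…/E_p]^{1/2}` and [KLS1988PRL] eq. (7) at positive temperature, `e₁ ≤ |Λ|⁻¹ĝ₀ + ½√e₁ R_L + T_L/(2β)` with `T_L = L^{-d}Σ_{p≠0}E_p⁻¹` (`kls_thermal_ineq7`), the quantum XY model of every spin has Gibbs-state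 long-range order along the even tori in EVERY `d ≥ 2` along any schedule `β_L ≥ β₀(1 + T_L)` (`xy_gibbs_evenTorusLRO_of_schedule`); in `d = 2`, `T_L ≤ (1 + log L)²` (`torusGreen_zero_two_le`; classically `T_L ∼ π⁻¹ log L`), so the polylogarithmic schedule `β_L = β₀(1 + (1 + log L)²)` carries two-point, `U(1)`-breaking, positive-temperature long-range order in two dimensions (`xy_gibbs_evenTorusLRO_two_polylog`) — in a model obeying this very barrier at every fixed `T > 0` [cite: KomaTasakiPRL1992, footnote [11]] [cite: KLS1988PRL, Theorem, eqs. (3)–(8)] [cite: DysonLiebSimon1978, Thms. 4.2, 5.1 (as cited in KLS1988PRL, ref. 1)]; (x) the helicity modulus / superfluid stiffness and the BKT `T_c` [cite: PaivaEtAl2004, pp. 2–4] [cite: NelsonKosterlitz1977, title claim]; (xi) charge-neutral (vestigial) composites of pairs with Ising-like LRO at `T > 0` [cite: FernandesOrthSchmalian2019, arXiv pp. 8 and 10]. None of (ix)–(xi) is a claim that such a route reaches the summit for the Hubbard model ((ix) needs a substitute for reflection positivity, (x)–(xi) certify a superconducting or paired PHASE at `T > 0`, not ground-state pair-field LRO)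 — only that this barrier does not speak to them.
scope_caveats: those of `PositiveTemperatureNoPairLRO`, corrected: the bond / `d_{x²-y²}` pair-field extension of Theorem (2) (footnote [10]) IS proved in the tree, in the sibling entry `HohenbergMerminWagnerPairing` (`not_hasTorusLRO_thermal_dWave`, every finite-range singlet pair field `localPair g`), so "NOT proved in the tree" there is outdated; conjuncts (2)–(3) are stated with the constants of `HubbardHubbardModelKomaTasakiProofs` (`C = e`, exponent `1/(128β|t| + 1)`), cruder than the printed `αf(β)`, `α = (2πt)⁻¹`, `f(β) ≈ β⁻¹` for `β ≫ 4/t` [cite: KomaTasakiPRL1992, Theorem and footnote [9]] — with the printed constants the edge reads `2πβt ≳ log(dist)`: at `βt = 4` the printed bound `2|x - y|^{-αf(β)}` is still `≥ 2e⁻¹` for all `|x - y| ≤ e^{8π} ≈ 8·10¹⁰`, so against finite-`T` NUMERICS at `βt ≳ 4` on any simulable lattice the barrier is void in practice (it forbids only the extrapolation "in `L` at fixed `T`" in principle); conjunct (2) is grand-canonical on the full Fock space of the torus with nearest-neighbour `t` (`hubbardTorusWith`), like conjunct (1) — the canonical / `S^z`-sector Gibbs states of the summit's sector, next-nearest-neighbour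 `t'`, general finite-range hopping and "arbitrary" `V({n_{x,σ}})` are covered by the printed proof (the gauge transformation is a function of the number operators and preserves every such sector and interaction) but not formalized [cite: KomaTasakiPRL1992, eq. (1) and p. 2 ("Our result is independent of ρ and thus applies to grand canonical averages as well")]; the schedule frontier `β_L|t| ≍ log L` is located only up to the constants `128` (tree) vs `2π` (print); the audit found no literature asserting two-point LRO of a two-dimensional Hubbard Gibbs state at fixed `T > 0` — nothing contradicts conjunct (1) — and the literature's "`T_c` of the 2D Hubbard model" is throughout the BKT temperature of item (x), consistent with it.
status: established (all three conjuncts proved in this file: `positiveTemperatureNoPairLRONarrow_holds`; conjunct (1) is the catalogued theorem, `positiveTemperatureNoPairLRO_of_narrow`; the witness beyond the edge, `xy_gibbs_evenTorusLRO_two_polylog`, is proved in section Witness)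
[cite: KomaTasakiPRL1992, Theorem eqs. (2), (4), p. 3 and footnotes [9], [10]] [cite: PaivaEtAl2004, pp. 2–4] [cite: FernandesOrthSchmalian2019, arXiv pp. 8 and 10] -/
def PositiveTemperatureNoPairLRONarrow : Prop :=
  PositiveTemperatureNoPairLRO ∧
    (∀ (t U μ : ℝ) (β : ℕ → ℝ), (∀ L, 0 ≤ β L) →
      Tendsto (fun L : ℕ => Real.log (L : ℝ) / (1 + β L * |t|)) atTop atTop →
        ¬ HasTorusLRO (fun L => thermalPairCorr (d := 2) (β L) t U μ L) ∧
          ¬ HasTorusLRO (fun L => thermalSpinCorr (d := 2) (β L) t U μ L)) ∧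
    ∀ (t U μ β : ℝ), 0 ≤ β → ∀ (L : ℕ) [NeZero L] (x y : TorusSite 2 L),
      Real.log ((L : ℝ) + 1) ≤ 128 * (β * |t|) + 1 →
        ‖(hubbardTorusWith 2 L t U μ).thermalCorr β (onSitePair x)ᴴ (onSitePair y)‖ ≤ 1 ∧
          ‖(hubbardTorusWith 2 L t U μ).thermalCorr β (siteSpinPlus x) (siteSpinPlus y)ᴴ‖ ≤ 1 ∧
            1 ≤ Real.exp 1 * ((torusDist x y : ℝ) + 1) ^ (-(1 / (128 * (β * |t|) + 1)))

/-- **Proof of the narrowed barrier**: conjunct (1) is `PositiveTemperatureNoPairLRO_holds`;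
conjunct (2) is `not_hasTorusLRO_thermal_of_schedule`; conjunct (3) combines
`norm_thermalCorr_onSitePair_le_one`, `norm_thermalCorr_siteSpinPlus_le_one` and
`one_le_komaTasakiBound_of_log_le`. [cite: KomaTasakiPRL1992, Theorem eqs. (2), (4) and p. 3] -/
theorem positiveTemperatureNoPairLRONarrow_holds : PositiveTemperatureNoPairLRONarrow :=
  ⟨PositiveTemperatureNoPairLRO_holds,
    fun t U μ _β hβ0 hβ => not_hasTorusLRO_thermal_of_schedule t U μ hβ0 hβ,
    fun t U μ _β hβ _L _ x y hL =>
      ⟨norm_thermalCorr_onSitePair_le_one t U μ hβ x y,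
        norm_thermalCorr_siteSpinPlus_le_one t U μ hβ x y,
        one_le_komaTasakiBound_of_log_le (mul_nonneg hβ (abs_nonneg t)) x y hL⟩⟩

/-- The narrowed statement contains the catalogued one (its first conjunct). [folklore] -/
theorem positiveTemperatureNoPairLRO_of_narrow (h : PositiveTemperatureNoPairLRONarrow) :
    PositiveTemperatureNoPairLRO :=
  h.1

/-- **The reach in one line, for users**: no pair and no transverse-spin torus long-range order
of the two-dimensional Hubbard Gibbs states along any temperature schedule `β_L ≥ 0` with
`log L / (1 + β_L|t|) → ∞`. [cite: KomaTasakiPRL1992, Theorem and p. 3] -/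
theorem PositiveTemperatureNoPairLRONarrow.not_LRO_of_schedule (t U μ : ℝ) {β : ℕ → ℝ}
    (hβ0 : ∀ L, 0 ≤ β L)
    (hβ : Tendsto (fun L : ℕ => Real.log (L : ℝ) / (1 + β L * |t|)) atTop atTop) :
    ¬ HasTorusLRO (fun L => thermalPairCorr (d := 2) (β L) t U μ L) ∧
      ¬ HasTorusLRO (fun L => thermalSpinCorr (d := 2) (β L) t U μ L) :=
  positiveTemperatureNoPairLRONarrow_holds.2.1 t U μ β hβ0 hβ

/-- **Containment check**: the constant schedule `β_L ≡ β ≥ 0` satisfies the hypothesis of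
conjunct (2) (`log L / (1 + β|t|) → ∞`), so conjunct (2) re-proves the catalogued corollary
`koma_tasaki_noLRO` (and extends it to `β = 0`). [cite: KomaTasakiPRL1992, p. 3] -/
theorem PositiveTemperatureNoPairLRONarrow.not_LRO_const (t U μ β : ℝ) (hβ : 0 ≤ β) :
    ¬ HasTorusLRO (thermalPairCorr (d := 2) β t U μ) ∧
      ¬ HasTorusLRO (thermalSpinCorr (d := 2) β t U μ) := by
  have hlog : Tendsto (fun L : ℕ => Real.log (L : ℝ)) atTop atTop :=
    Real.tendsto_log_atTop.comp tendsto_natCast_atTop_atTop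
  have hc : (0 : ℝ) < 1 + β * |t| := by positivity
  exact PositiveTemperatureNoPairLRONarrow.not_LRO_of_schedule t U μ (β := fun _ => β)
    (fun _ => hβ) (hlog.atTop_div_const hc)

/-- **The edge in one line, for users**: at `β ≥ 0` with `log(L + 1) ≤ 128 β|t| + 1`, the
tree's explicit Koma–Tasaki bound at any two sites of the `L`-torus is no better than the a
priori bound `1` on both correlations. [cite: KomaTasakiPRL1992, p. 3] -/
theorem PositiveTemperatureNoPairLRONarrow.bound_void_of_log_le (t U μ : ℝ) {β : ℝ}
    (hβ : 0 ≤ β) (L : ℕ) [NeZero L] (x y : TorusSite 2 L)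
    (hL : Real.log ((L : ℝ) + 1) ≤ 128 * (β * |t|) + 1) :
    ‖(hubbardTorusWith 2 L t U μ).thermalCorr β (onSitePair x)ᴴ (onSitePair y)‖ ≤ 1 ∧
      ‖(hubbardTorusWith 2 L t U μ).thermalCorr β (siteSpinPlus x) (siteSpinPlus y)ᴴ‖ ≤ 1 ∧
        1 ≤ Real.exp 1 * ((torusDist x y : ℝ) + 1) ^ (-(1 / (128 * (β * |t|) + 1))) :=
  positiveTemperatureNoPairLRONarrow_holds.2.2 t U μ β hβ L x y hL

end Literature.Barriers.HubbardSuperconductivity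

end
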